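import Summits.CriticalPhenomena.Ising3DConformalLimit.Theses.HyperoctahedralRP
import Literature.Barriers.CriticalPhenomena.ScaleCovarianceNotMoebius
import Literature.Probability.LatticeModels.CriticalWickDichotomy
import Literature.Probability.LatticeModels.CriticalScalingDimension
import Literature.MathematicalPhysics.QuantumFieldTheory.PointwiseOSReconstruction
import Summits.CriticalPhenomena.Ising3DConformalLimit.Theorems.IsingEuclidUpgradeRefutations
import Summits.CriticalPhenomena.Ising3DConformalLimit.Theorems.HyperoctahedralRPInversionUpgradeNormalisedConditional

/-!
# Disproof of `InversionUpgradeNormalised` (item stmt-CriticalPhenomena-1982) — findings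

Work file of the STANDING CRUX DISPROVER (cdisprove; gen 3 = cycle 3; v12 = cycle-3 final, 2026-08-16). Every
conclusive section is ALSO a landed (or submitted) tree file, listed next. Crux (route decl
`HyperoctahedralRP.InversionUpgradeNormalised`, shared verbatim by PlanarCornerRotations /
TauBallRounding / ModularBoosts / HarmonicMomentsIsotropy / VolterraWard / GaussianScaleMixture):

  ∀ ρ Δ S, (H1) ρ > 0 on (0,1] → (H2) HasPointwiseScalingLimit (criticalCorr 3) ρ S →
    (H3) S = 0 off NonCoincident → (H4) IsNondegenerateTwoPoint S → (H5) IsEuclideanInvariant S →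
    (H6) IsScaleCovariant Δ S → IsInversionCovariant Δ S.

VERDICT SO FAR: **resists** (three cycles). (H2)+(H3) pin `S` completely (on `NonCoincident` by
the locally uniform limit of the ACTUAL critical Ising correlators, `0` elsewhere), (H4)+(H6) pin
`Δ ∈ [1/2, 3/4]`, and the guards of `IsInversionCovariant` map non-coincident configurations to
non-coincident ones — there is NO junk instance; a counterexample would have to be the Ising₃
scaling limit itself, shown to exist, to be `O(3)`- and scale-covariant and NOT conformally
covariant at some even order `n ≥ 4` (`crux_iff_evenFromFour`). Physics expects the opposite
(DTW 2016; bootstrap; MC `Δ_V > 5`), and no construction of the limit exists (ICM 2022 §8.4).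
Everything below is `lean check` rc 0; the ONLY `sorry` is the explicitly marked open question of §7'.

LANDED TREE THEOREMS (all `Summit.CriticalPhenomena.Ising3DConformalLimit.InversionUpgradeNormalisedNegative.*`,
directory `Theorems/InversionUpgradeNormalised/Negative/`, importable by ideators/planners/leads):
* `AutomaticOrders.lean` (p71773): `crux_iff_evenFromFour`, `invIdentity_zero/odd/two`,
  `two_point_eq`, `two_point_inversion`, `limit_zero_eq_one`, `delta_mem_Icc_of_hyp`,
  `crux_at_of_not_mem_window`.
* `LoadBearingHypotheses.lean` (p71980): `not_cruxWithoutIsingLimit`, `not_cruxWithoutNormalisation`,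
  `not_cruxWithoutScaleCovariance`, `exists_hyp_of_euclideanLimit`, `weight_unique_of_two`,
  `hasPointwiseScalingLimit_abs_iff`, `not_unguarded`, `not_cruxUnguarded`, `inversion_weight_eq`.
* `ReflectionMonotone.lean` (p71655): `narrowFamily_reflectionMonotone`,
  `not_inversionUpgrade_of_reflectionMonotone`, `not_cruxWithReflectionMonotone`.
* `NotReflectionPositive.lean` (p71548): `narrowFamily_not_reflectionPositive`,
  `narrowFamily_not_pointwiseOSReconstruction`, `narrowFamily_four_pos`.
* `SixPointWitness.lean` (p71951) + `SixPoint.lean` (p72671): `sixFamily`,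
  `fourPoint_does_not_propagate`, `not_inversionUpgrade_from_low_orders` (§7).
* `ReflectionPositiveOrders.lean` (p72408): `even_order_ne_zero_of_reflectionPositive` (§7'').
* `SharperWindow.lean` (p72840): `delta_mem_sharpWindow_of_hyp` (`Δ ∈ [1/2, 3/4]`),
  `crux_iff_sharpWindow`, `no_hyp_with_delta_gt_three_quarters`.
* cycle 1: barrier file `ScaleCovarianceNotMoebius` += `narrowFamily_hasPointwiseScalingLimit`,
  `not_inversionUpgrade_of_latticeLimit_at` (p68577).
* **cycle 3 (see §3, §8–§9), ALL SIX ACCEPTED:** `DownwardRigidity.lean` (p74911: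
  `rp_three`, `downward_step`, `downward_rigidity`, `ratio_sq_le_one`, `osSym_row_eq_of_degenerate`,
  `osSym_empty_timeShift`), `DownwardRigidityWickFour.lean` (p75263: `wick_downward_two`,
  `exists_gamma_two_point_of_wick_four`, `tendsto_twoPt_cross`), `WickEight.lean` (p75545: `wick8` =
  the 105-matching Gaussian eight-point function, `cfg4`, `osEightExpr`),
  `DownwardRigidityWickEight.lean` (p77289: `tendsto_osEightExpr`, `wick8_downward_four`,
  `exists_gamma_four_point_of_wick_eight`, **`invIdentity_four_of_wick_eight`**, `osSym_eq_osPointKernel`),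
  `ScaleZeroDressing.lean` (p75577: `scaleZero_three_eq_of_separated`), `RedundantHypotheses.lean`
  (p77161: `eq_zero_of_degenerate`, `isInversionCovariant_of_degenerate`,
  `crux_iff_withoutNondegeneracy`, `crux_iff_bare`).
* POSITIVE tree files landed meanwhile by the lead of line `free-endpoint-gaussian-closure`
  (namespace `…Cruxes.InversionUpgradeNormalised.FreeEndpointGaussianClosure`), usable by every line:
  `stub_gaussianDomination` (`S_{2n} ≤ 𝒢_n[S₂]` in the limit), `stub_latticeRP` (site-mirror
  reflection positivity of `criticalCorr 3` along each axis — the lattice input for RP of `S`),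
  `stub_pairTruncation` (GKS II / Glimm–Jaffe Cor. 4.3.3 pair truncation in the limit).

## Findings (index)

* §0 READ-BACK — `Crux`, `Hyp` (the six hypotheses bundled), `crux_iff`.
* §1 AUTOMATIC INSTANCES — orders `0`, odd (`m*(β_c) = 0`), `2` (model-blind) are automatic:
  `crux_iff_evenFromFour`: the crux IS the conformal covariance of `S₄, S₆, …` of the pinned limit.
* §2 PINNED DATA — `limit_zero_eq_one` (`S₀ ≡ 1`), `delta_mem_Icc` (`Δ ∈ [1/2,1]`), vacuous off
  the window (`crux_at_of_not_mem_window`); SHARPER in tree: `Δ ∈ [1/2, 3/4]` (`SharperWindow.lean`).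
* §3 LOAD-BEARING — (H2) at EVERY `Δ > 0` and not weakenable to generic lattice provenance
  (`not_cruxWithGenericLattice`); (H3), (H6) given `CritIsing3DEuclideanLimit`; (H1) sign-insensitive.
  NEW (cycle 3, tree `Negative/RedundantHypotheses.lean`, p77161): **(H4) is REDUNDANT**
  (`crux_iff_withoutNondegeneracy`: a degenerate instance is `S = (1,0,0,…)` — Griffiths I + Lebowitz
  in the limit + the Aizenman–Newman dichotomy — and satisfies the conclusion) and **the translation
  half of (H5) is AUTOMATIC** for normalised pointwise limits (sibling disprover's
  `translation_redundant`), so **`crux_iff_bare`: crux ⇔ "(H1)+(H2)+(H3)+`O(3)` invariance+(H6) ⇒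
  inversion covariance"** — the content is the lattice clause, the normalisation and ROTATION
  invariance (the route's sibling crux); (H6) with some exponent is itself automatic for
  non-degenerate limits (`scale_redundant`) and the exponent is forced (`weight_unique_of_two`).
* §4 STRENGTHENINGS REFUTED — origin guard necessary; weight forced.
* §5 REFLECTION MONOTONICITY IS INSIDE THE BLOCKED CLASS (cycle 2, landed): MMS /
  Hegerfeldt–Schrader `S(A ⊔ θB) ≤ S(A ⊔ B)` holds for `narrowFamily Δ` (every mirror, all orders,
  `Δ ≥ 1/2`), so "(1)–(13) of the barrier + MMS ⇒ inversion covariance" is FALSE model-blind.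
* §6 THE NO-GO WITNESSES ARE NOT OS-POSITIVE (landed): the class of §3–§5 is disjoint from RP.
* §7 (SixPt, PROVED) FOUR-POINT COVARIANCE DOES NOT PROPAGATE model-blind: `sixFamily Δ` has
  (H3)–(H6), `U₄ ≤ 0`, the inversion identity at every order `n ≠ 6`, and violates it at `n = 6`.
* §7'' (PROVED) RP FORCES EVERY EVEN ORDER ≠ 0 (any `d`, any axis).
* **§8 (NEW, cycle 3, PROVED) DOWNWARD RIGIDITY UNDER RP.** Positivity of the `3 × 3` OS Gram
  matrix of `(∅, a_L, b_L)` (`rp_three`, `downward_step`): if `S` is RP along one axis, `S₀ = 1`,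
  translation invariant, and its `2n`-point OS entries CLUSTER onto a product `R(a)R(b)` when the two
  `n`-point configurations are pushed away from the mirror, then `S_n = γ·R` with ONE constant
  `γ`, `γ² ≤ 1` (`downward_rigidity`, `ratio_sq_le_one`). Gaussian instances, fully on tree objects:
  `S₄ = wick Δ ⇒ S₂ = γ·twoPt Δ` (`exists_gamma_two_point_of_wick_four`, here and landed) and —
  landed file `DownwardRigidityWickEight.lean`, 105-matching bookkeeping generated mechanically —
  **`S₈ = wick8 Δ ⇒ S₄ = γ·wick Δ ⇒ the inversion identity AT ORDER FOUR`**
  (`invIdentity_four_of_wick_eight`). CONSEQUENCES: (i) with RP, conformality propagates DOWNWARD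
  dyadically (`2n ↦ n`), whereas §7 showed it does not propagate upward model-blind; (ii) an RP
  decoy (§7') can NOT be a finite-order deformation of the generalized free field: it is
  non-Gaussian at ALL orders `4, 8, 16, …` simultaneously (if `S_{2^k} ∝` Gaussian for one `k ≥ 3`
  then `S₄ ∝ wick`, covariant); together with §7'' (no zero even order) and the Wick dichotomy
  (`U₄ ≡ 0 ⇒` Gaussian at all orders, for Ising limits) this closes every "perturb one order"
  construction; (iii) for the PINNED `S` of the crux (RP along the axes passes to the limit from
  lattice RP through bond planes, `[θx/δ] = θ'[x/δ]`), `S₄/W` non-constant ⇒ `S₈` non-Gaussian in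
  the precise OS-clustering sense — a quantitative handle, not a proof strategy.
* **§9 (NEW, cycle 3, PROVED) WEIGHT-`0` DRESSINGS ARE RIGID.** The Schur-product attempt at a
  decoy, `S = GFF_Δ ⊙ K` (orderwise product: RP, Euclid, scale preserved; weights add) with an RP,
  Euclidean-invariant, scale-INVARIANT shape factor `K`: by `two_point_eq` at `Δ = 0`, `K₂` is
  constant, the one-point OS vectors of `K` are degenerate, hence (`osSym_row_eq_of_degenerate`)
  `K₃(p,q,r) = K₃(p',q,r)` whenever `p, p'` are strictly separated from `q ≠ r` by an affine
  hyperplane (`scaleZero_three_eq_of_separated`; any direction, via `Submodule.reflection_sub`).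
  So a continuous symmetric weight-`0` RP family is constant at order `3` off the segment and (same
  argument off the triangle) at order `4`: no decoy this way.
* §7' (LowΔ, OPEN — the only `sorry`) `rpDecoyInWindow`: an OS-positive decoy with `Δ ∈ [1/2,1]`?
  Cycle-3 additions to its obstruction list: (e) §9; (f) §8; (g) Poissonian scaling soups
  `φ = ∫ Ñ(dy,dr) r^{-Δ} g((x-y)/r)` (intensity `dy dr/r⁴`: `O(3)`, self-similar with weight `Δ`,
  all cumulants scale correctly) are RP only through a domain-Markov decomposition of the soup
  elements across the mirror (Brownian / Markov loops: YES — but their local-time functionals are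
  permanental, i.e. necklaces of `twoPt`, hence conformal at every intensity; rigid shapes such as
  balls or needles: NO — the reflection-odd height functional `y_τ·1[crossing]` makes the
  one-particle OS form negative, and second quantisation inherits it at small intensity);
  (h) a symmetric, Euclidean-covariant, RP, tempered decoy IS (OS reconstruction, locality from
  symmetry) a unitary scale-invariant NON-conformal Wightman QFT in `2+1` dimensions with a scalar of
  dimension `≤ 1`; inside any unitary CFT such a scalar is primary (descendants `□χ`, `∂·V` have
  `Δ ≥ 5/2`), so the decoy's theory is a genuine unitary SFT ≠ CFT with a light scalar — none is
  known in `d = 3` and none is excluded: "It is still an open question if scale invariance implies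
  conformal invariance in interacting and unitary quantum field theories in three dimensions"
  (Gimenez-Grau–Nakayama–Rychkov, arXiv:2309.02514, §8 p. 28, read; footnote 26: even in `d = 4`
  the `T^μ_μ = ∂²A + B` loophole with a dimension-2 scalar is open). Their interacting, local,
  scale-without-conformal dipolar (Aharony–Fisher) fixed point is NOT unitary (ibid. §4,
  eqs. (4.3)–(4.9), pp. 12–13: reflection positivity of `⟨φ_iφ_j⟩` would force `γ_φ ≥ 1/2`, the
  Källén–Lehmann measure condition even `γ_φ ≥ 1`, against `η_dip = 2γ_φ = 0.033(8)`), so it is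
  no RP decoy in any sector — the same two-point obstruction that kills every vector-dressing of a
  `Δ = 1/2` multiplet here (componentwise OS form `(a + bE t)e^{-Et}` completely monotone ⇒ `b = 0`);
  (i) (cycle 3, COMPUTED, item evidence `toy/a2_rp_pure.py` + `a2_rp_results.json`) the natural
  COMPOSITE evasion of (h)'s two-point obstruction — the scalar `φ = :G·G:` of the isotropic Gaussian
  vector field `M_ij(x) = (δ_ij + b x̂_ix̂_j)/|x|^{2Δ_G}` (`Δ_G = 1/2`: the free photon in the covariant
  `ξ`-gauge, `ξ = (1-b)/(1+b)`, `φ = :A²:_ξ`; `b = -1`: `|∇χ|²`), which is `O(3)`×scale covariant with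
  `Δ = 2Δ_G` in the window, permutation symmetric, non-conformal for `b ≠ 0` (traces of products of
  non-conformal tensors around the Wick cycles) and has the conformal two-point function — is NOT
  reflection positive unless `b = 0` (= the conformal free `φ²` triplet): its pointwise OS Gram
  matrices on configurations of sizes `0–3` (orders `≤ 6`) are negative in 56/56 tested cases with
  `b ≠ 0` and transverse spread `σ > 0` (min eigenvalue ≈ `-2·10⁻³` normalised at `σ = 0.1`, down to
  `-1.8·10⁻²`; `Δ_G ∈ {1/2, 0.35}`), PSD in 24/24 with `b = 0` or `σ = 0` (exactly axial
  configurations, where the family coincides with three independent scalar squares) — the violation is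
  carried exactly by the transverse, non-conformal shape dependence. The spin-2 analogue
  `φ = :T_ijT_ij:` (general isotropic symmetric-tensor Gaussian, five structures; `toy/t2_rp_pure.py`)
  behaves identically: the shape-independent structures (`α, β`: multiplets of scalars, sums of
  squares, conformal) stay PSD, every `n̂`-dependent deformation tested (`γ, ε, ζ ≠ 0`) is negative on
  near-axial configurations with `σ > 0` (to `-6.7·10⁻³`) and PSD at `σ = 0`. Gaussian composites with
  non-conformal index structure give no RP decoy.
* §10 (REMARK for provers, print only): under the full OS package for the limit (moments of a measure
  on `𝒮'` with OS0–3), the `S_n` are REAL-ANALYTIC at non-coinciding points (Glimm–Jaffe 1987,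
  Cor. 19.5.6, p. 312, read) — so the crux's inversion identity at order `n` follows from its
  validity on ANY non-empty open set of configurations avoiding `0` (identity theorem; inversion is
  real-analytic there): a line may restrict itself to general-position or near-OPE configurations.
  The registered targets' cospherical "automatic locus" (`‖xᵢ‖` all equal) is only codimension `3`,
  not open, so it does not suffice by itself.
* `-- Targets` (cycle 3): the registered skeleton (line `inversion-defect-involution`, lead
  `prover-line-stmt-CriticalPhenomena-1982-0`) has exactly two open stubs, C = `stub_latticeFour`
  and D = `stub_latticeHigher`; by the lead's landed `InversionUpgradeNormalised_iff_latticeOneSided`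
  (re-exported below as `targets_iff_crux`) **C ∧ D ⇔ crux**, C ⇔ the `n = 4` inversion identity
  of the pinned limit and D ⇔ the orders `≥ 6` (given the landed A, B): neither target is killable
  below crux level (`stub_false` for C would be `¬ Crux`), and both are TRUE under the conformal
  conjecture. The ε-free sharpening of C (exact finite-mesh domination `R^δ(x) ≤ R^δ(ιx)`) is FALSE
  in the solvable `d = 2` model (drefute-g2, exact Toeplitz computation, item evidence
  `stub_latticeFour-g2.md`): C has zero slack also numerically.

## Why it resists (for provers)

1. No junk: `S|NonCoincident` = the limit, `S|coincident = 0`, `Δ ∈ [1/2,3/4]`, `S₀ = 1`, odd `= 0`.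
2. Every model-blind surrogate tried is satisfied by `narrowFamily Δ` (13 properties of the barrier +
   lattice provenance + reflection monotonicity), which is not covariant: the proof must use a
   property `narrowFamily` lacks. Known candidates: OS positivity of ALL orders jointly (§6, §8),
   Aizenman's random-current identity for `U₄`, `criticalCorr`-specific Ward/switching identities,
   locality/stress tensor (no lattice theorem), absence of a `Δ = 2` vector operator (DTW 2016 §5–6,
   physics).
3. Four-point covariance is not enough model-blind (§7); WITH RP, Gaussianity/conformality of order
   `2n` controls order `n` (§8) — the only rigorous inter-order transfer found so far goes downward.
4. An RP decoy in the window would kill every "RP + symmetry + scale" line at once; none is known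
   and none is excluded (§7', with obstructions (a)–(i)): it must be non-Gaussian at all dyadic
   orders (§8), have no zero even order (§7''), no weight-`0` factorisation (§9), and amounts to a
   unitary SFT ≠ CFT with a light scalar in `d = 3`.
5. The registered targets C, D are the crux itself in lattice clothing (`targets_iff_crux`).
6. Direct numerical falsification needs the lattice four-point function at separations 8–24 on
   `L ≥ 128` to ≪ 1 % with controlled corrections-to-scaling `∝ r^{-0.83}`; not attempted (a null
   result at reachable precision would not discriminate; the ε-free variant is refuted exactly in 2D).
-/

noncomputable section

namespace Summit.CriticalPhenomena.Ising3DConformalLimit.Cruxes.InversionUpgradeNormalised.Disproof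

open Literature.Probability.LatticeModels Literature.Barriers.CriticalPhenomena
open Literature.MathematicalPhysics.QuantumFieldTheory
open Filter Set Function EuclideanGeometry ScaleNotMoebius Finset
open scoped Topology

/-! ## §0 Read-back -/

/-- The crux, by name. [folklore] -/
abbrev Crux : Prop :=
  Summit.CriticalPhenomena.Ising3DConformalLimit.Theses.HyperoctahedralRP.InversionUpgradeNormalised

/-- The six hypotheses of the crux on `(ρ, Δ, S)`, bundled: (H1) `ρ > 0` on `(0,1]`,
(H2) pointwise scaling limit of `criticalCorr 3`, (H3) normalisation off `NonCoincident`,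
(H4) non-degenerate two-point function, (H5) Euclidean invariance, (H6) scale covariance. [folklore] -/
structure Hyp (ρ : ℝ → ℝ) (Δ : ℝ) (S : CorrFamily 3) : Prop where
  rho_pos : ∀ δ ∈ Set.Ioc (0:ℝ) 1, 0 < ρ δ
  lim : HasPointwiseScalingLimit (criticalCorr 3) ρ S
  norm : ∀ n z, z ∉ NonCoincident 3 n → S n z = 0
  nondeg : IsNondegenerateTwoPoint S
  euclid : IsEuclideanInvariant S
  scale : IsScaleCovariant Δ S

/-- Read-back: the crux says `Hyp ρ Δ S → IsInversionCovariant Δ S`. [folklore] -/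
theorem crux_iff : Crux ↔ ∀ (ρ : ℝ → ℝ) (Δ : ℝ) (S : CorrFamily 3), Hyp ρ Δ S → IsInversionCovariant Δ S := by
  constructor
  · intro h ρ Δ S hh
    exact h ρ Δ S hh.rho_pos hh.lim hh.norm hh.nondeg hh.euclid hh.scale
  · intro h ρ Δ S h1 h2 h3 h4 h5 h6
    exact h ρ Δ S ⟨h1, h2, h3, h4, h5, h6⟩

/-! ## §1 Automatic instances of the conclusion -/

/-- The inversion identity of order `n` for `S` with weight `Δ` (one clause of
`IsInversionCovariant`). [folklore] -/
def InvIdentityAt (Δ : ℝ) (S : CorrFamily 3) (n : ℕ) : Prop :=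
  ∀ x : Fin n → EuclideanSpace ℝ (Fin 3), (∀ i, x i ≠ 0) →
    S n (fun i => inversion 0 1 (x i)) = (∏ i, ‖x i‖ ^ (2 * Δ)) * S n x

/-- `IsInversionCovariant` is the conjunction of the order-`n` identities. [folklore] -/
theorem isInversionCovariant_iff_forall (Δ : ℝ) (S : CorrFamily 3) :
    IsInversionCovariant Δ S ↔ ∀ n, InvIdentityAt Δ S n := Iff.rfl

/-- `n = 0`: automatic for every family. [folklore] -/
theorem invIdentityAt_zero (Δ : ℝ) (S : CorrFamily 3) : InvIdentityAt Δ S 0 := by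
  intro x _
  have hx : (fun i => inversion 0 1 (x i)) = x := funext fun i => i.elim0
  simp [hx]

/-- Inverting a configuration avoiding `0` preserves (non-)injectivity. [folklore] -/
theorem injective_inversion_comp_iff {n : ℕ} {x : Fin n → EuclideanSpace ℝ (Fin 3)} :
    Function.Injective (fun i => inversion (0 : EuclideanSpace ℝ (Fin 3)) 1 (x i)) ↔ Function.Injective x := by
  constructor
  · intro h i j hij
    exact h (by simp [hij])
  · intro h i j hij
    exact h (inversion_injective (0 : EuclideanSpace ℝ (Fin 3)) one_ne_zero hij)

/-- If `S n` vanishes identically, the order-`n` identity holds. [folklore] -/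
theorem invIdentityAt_of_eq_zero {Δ : ℝ} {S : CorrFamily 3} {n : ℕ} (h : ∀ x, S n x = 0) :
    InvIdentityAt Δ S n := by
  intro x _
  simp [h]

/-- ODD ORDERS vanish for limits of `criticalCorr 3`: `S n ≡ 0` (on `NonCoincident` by
`m*(β_c) = 0`, tree theorem `HasPointwiseScalingLimit.eq_zero_of_odd`; off it by (H3)).
[cite: AizenmanDuminilCopinSidoraviciusCMP2015, Thm. 1.2] -/
theorem limit_odd_eq_zero {ρ : ℝ → ℝ} {S : CorrFamily 3}
    (hlim : HasPointwiseScalingLimit (criticalCorr 3) ρ S)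
    (hnorm : ∀ n z, z ∉ NonCoincident 3 n → S n z = 0) {n : ℕ} (hn : Odd n)
    (x : Fin n → EuclideanSpace ℝ (Fin 3)) : S n x = 0 := by
  by_cases hx : x ∈ NonCoincident 3 n
  · exact hlim.eq_zero_of_odd (by norm_num) hn hx
  · exact hnorm n x hx

/-- ODD ORDERS of the conclusion are automatic under (H2) + (H3). [folklore] -/
theorem invIdentityAt_odd {ρ : ℝ → ℝ} {Δ : ℝ} {S : CorrFamily 3} (h : Hyp ρ Δ S) {n : ℕ} (hn : Odd n) :
    InvIdentityAt Δ S n :=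
  invIdentityAt_of_eq_zero (limit_odd_eq_zero h.lim h.norm hn)

/-- Two-point structure of a Euclidean-invariant, scale-covariant family: for `a ≠ b`,
`S₂(a,b) = ‖a - b‖^{-2Δ} · S₂(0,e₀)` (translate, reflect with `Submodule.reflection_sub`, scale;
the argument of `Ideator2Sketch.two_point_eq`). MODEL-BLIND. [folklore] -/
theorem two_point_eq {Δ : ℝ} {S : CorrFamily 3} (heuc : IsEuclideanInvariant S)
    (hsc : IsScaleCovariant Δ S) {a b : EuclideanSpace ℝ (Fin 3)} (hab : a ≠ b) :
    S 2 ![a, b] = ‖a - b‖ ^ (-(2 * Δ)) * S 2 ![0, EuclideanSpace.single 0 1] := by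
  set e : EuclideanSpace ℝ (Fin 3) := EuclideanSpace.single 0 1 with he
  have hne : ‖e‖ = 1 := by simp [he]
  set r : ℝ := ‖b - a‖ with hr
  have hr0 : 0 < r := norm_pos_iff.mpr (sub_ne_zero.mpr (Ne.symm hab))
  have h1 : S 2 ![a, b] = S 2 ![0, b - a] := by
    have h := heuc.1 2 (-a) ![a, b]
    rw [← h]
    congr 1
    funext i
    fin_cases i <;> simp [sub_eq_add_neg]
  have hnorm_eq : ‖b - a‖ = ‖r • e‖ := by
    rw [norm_smul, hne, mul_one, Real.norm_eq_abs, abs_of_pos hr0]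
  have hRv : Submodule.reflection (ℝ ∙ ((b - a) - r • e))ᗮ (b - a) = r • e :=
    Submodule.reflection_sub hnorm_eq
  have h2 : S 2 ![0, b - a] = S 2 ![0, r • e] := by
    have h := heuc.2 2 (Submodule.reflection (ℝ ∙ ((b - a) - r • e))ᗮ) ![0, b - a]
    rw [← h]
    congr 1
    funext i
    fin_cases i <;> simp [hRv]
  have h3 : S 2 ![0, r • e] = r ^ (-(2 * Δ)) * S 2 ![0, e] := by
    have h := hsc 2 r hr0 ![0, e]
    have hfun : (fun i => r • (![0, e] : Fin 2 → EuclideanSpace ℝ (Fin 3)) i) = ![0, r • e] := by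
      funext i
      fin_cases i <;> simp
    have hexp : (-((2 : ℕ) : ℝ) * Δ) = -(2 * Δ) := by push_cast; ring
    rw [hfun, hexp] at h
    exact h
  rw [h1, h2, h3, hr, norm_sub_rev]

/-- MODEL-BLIND two-point inversion law for distinct non-zero points. [folklore] -/
theorem two_point_inversion {Δ : ℝ} {S : CorrFamily 3} (heuc : IsEuclideanInvariant S)
    (hsc : IsScaleCovariant Δ S) {p q : EuclideanSpace ℝ (Fin 3)} (hpq : p ≠ q) (hp : p ≠ 0)
    (hq : q ≠ 0) :
    S 2 ![inversion 0 1 p, inversion 0 1 q] = ‖p‖ ^ (2 * Δ) * ‖q‖ ^ (2 * Δ) * S 2 ![p, q] := by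
  have hinj := inversion_injective (0 : EuclideanSpace ℝ (Fin 3)) one_ne_zero
  have hpq' : inversion 0 1 p ≠ inversion 0 1 q := fun h => hpq (hinj h)
  rw [two_point_eq heuc hsc hpq', two_point_eq heuc hsc hpq]
  have key := ScaleNotMoebius.twoPt_inversion Δ hp hq
  simp only [ScaleNotMoebius.twoPt] at key
  rw [key]
  ring

/-- `n = 2` of the conclusion is automatic and MODEL-BLIND: it needs only (H3) normalisation,
(H5) Euclidean invariance and (H6) scale covariance (no lattice input, no positivity). [folklore] -/
theorem invIdentityAt_two {Δ : ℝ} {S : CorrFamily 3}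
    (hnorm : ∀ n z, z ∉ NonCoincident 3 n → S n z = 0)
    (heuc : IsEuclideanInvariant S) (hsc : IsScaleCovariant Δ S) : InvIdentityAt Δ S 2 := by
  intro x hx
  by_cases hinj : Function.Injective x
  · have h01 : x 0 ≠ x 1 := fun h => absurd (hinj h) (by decide)
    have hx2 : x = ![x 0, x 1] := by funext i; fin_cases i <;> rfl
    have hinv2 : (fun i => inversion (0 : EuclideanSpace ℝ (Fin 3)) 1 (x i)) = ![inversion 0 1 (x 0), inversion 0 1 (x 1)] := by
      funext i; fin_cases i <;> rfl
    rw [hinv2, Fin.prod_univ_two]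
    conv_rhs => rw [hx2]
    exact two_point_inversion heuc hsc h01 (hx 0) (hx 1)
  · have h1 : S 2 x = 0 := hnorm 2 x hinj
    have h2 : S 2 (fun i => inversion 0 1 (x i)) = 0 :=
      hnorm 2 _ (mt injective_inversion_comp_iff.1 hinj)
    rw [h1, h2, mul_zero]

/-- **REDUCTION.** The crux is equivalent to its EVEN orders `n ≥ 4`: orders `0`, `2` and all odd
orders of `IsInversionCovariant` are automatic under the hypotheses (`0`: empty product; odd:
`m*(β_c) = 0`; `2`: model-blind). So the whole content of the crux is the conformal covariance of
`S₄, S₆, …` of the pinned Ising₃ limit. [folklore] -/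
theorem crux_iff_evenFromFour :
    Crux ↔ ∀ (ρ : ℝ → ℝ) (Δ : ℝ) (S : CorrFamily 3), Hyp ρ Δ S →
      ∀ n, 4 ≤ n → Even n → InvIdentityAt Δ S n := by
  rw [crux_iff]
  constructor
  · intro h ρ Δ S hh n _ _
    exact (h ρ Δ S hh) n
  · intro h ρ Δ S hh n
    rcases Nat.even_or_odd n with hev | hodd
    · by_cases h4 : 4 ≤ n
      · exact h ρ Δ S hh n h4 hev
      · -- even and < 4: n = 0 or n = 2
        interval_cases n
        · exact invIdentityAt_zero Δ S
        · exact absurd hev (by decide)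
        · exact invIdentityAt_two hh.norm hh.euclid hh.scale
        · exact absurd hev (by decide)
    · exact invIdentityAt_odd hh hodd


/-! ## §2 Pinned data: `S₀ = 1`, odd orders `0`, `Δ ∈ [1/2, 1]` -/

/-- `⟨1⟩⁺_{β_c} = 1`: the empty spin monomial. [folklore] -/
theorem criticalCorr_fin_zero (x : Fin 0 → Site 3) : criticalCorr 3 0 x = 1 := by
  have hx : spinMonomial x = fun _ => (1:ℝ) := by
    funext s; simp [spinMonomial]
  show plusExpect 3 (criticalBeta 3) 0 (spinMonomial x) = 1
  rw [hx]
  show limUnder atTop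
      (fun L : ℕ => isingExpect (zdGraph 3) (box 3 L) (criticalBeta 3) 0 .plus (fun _ => (1:ℝ))) = 1
  simp_rw [isingExpect_const]
  exact tendsto_const_nhds.limUnder_eq

/-- ANY pointwise limit of the critical correlators has `S 0 ≡ 1` (so `ρ` cannot kill `S₀`, and
the `n = 0` clause is pinned, not merely automatic). [folklore] -/
theorem limit_zero_eq_one {ρ : ℝ → ℝ} {S : CorrFamily 3}
    (hlim : HasPointwiseScalingLimit (criticalCorr 3) ρ S) (x : Fin 0 → EuclideanSpace ℝ (Fin 3)) :
    S 0 x = 1 := by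
  have hx : x ∈ NonCoincident 3 0 := by
    rw [mem_nonCoincident]; intro i; exact Fin.elim0 i
  have h := (hlim 0).tendsto_at hx
  have h1 : Tendsto (fun δ => rescaledCorrelator (criticalCorr 3) ρ 0 δ x) (𝓝[>] (0:ℝ)) (𝓝 1) := by
    refine tendsto_const_nhds.congr fun δ => ?_
    rw [rescaledCorrelator_apply, pow_zero, one_mul, criticalCorr_fin_zero]
  exact tendsto_nhds_unique h h1

/-- **Δ is pinned to the Ising window**: (H1)+(H2)+(H4)+(H6) force `1/2 ≤ Δ ≤ 1` (infrared bound
and Simon–Lieb, tree theorem `scalingDimension_mem_Icc_holds`). In particular the crux at any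
`Δ ∉ [1/2, 1]` is VACUOUSLY true, and every decoy must live in the window. [cite: Simon1980, Thm. 1] -/
theorem delta_mem_Icc {ρ : ℝ → ℝ} {Δ : ℝ} {S : CorrFamily 3} (h : Hyp ρ Δ S) :
    Δ ∈ Set.Icc (1 / 2 : ℝ) 1 :=
  scalingDimension_mem_Icc_holds ρ Δ S h.lim h.scale h.nondeg h.rho_pos

/-- Hence `0 < Δ` for every instance of the hypotheses. [folklore] -/
theorem delta_pos {ρ : ℝ → ℝ} {Δ : ℝ} {S : CorrFamily 3} (h : Hyp ρ Δ S) : 0 < Δ := by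
  linarith [(delta_mem_Icc h).1]

/-- The crux restricted to a scaling dimension OUTSIDE the window holds vacuously. [folklore] -/
theorem crux_at_of_not_mem_window {Δ : ℝ} (hΔ : Δ ∉ Set.Icc (1 / 2 : ℝ) 1) :
    ∀ (ρ : ℝ → ℝ) (S : CorrFamily 3), Hyp ρ Δ S → IsInversionCovariant Δ S :=
  fun _ _ h => absurd (delta_mem_Icc h) hΔ

/-! ## §3 Load-bearing analysis: which hypotheses any proof must use -/

/-- The crux with the LATTICE CLAUSE (H1)+(H2) deleted (model-blind upgrade at weight `Δ`). [folklore] -/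
def CruxWithoutIsingLimit (Δ : ℝ) : Prop :=
  ∀ S : CorrFamily 3, (∀ n z, z ∉ NonCoincident 3 n → S n z = 0) → IsNondegenerateTwoPoint S →
    IsEuclideanInvariant S → IsScaleCovariant Δ S → IsInversionCovariant Δ S

/-- **(H2) is load-bearing at EVERY `Δ > 0`** (in particular on the whole window `[1/2, 1]` and at
the bootstrap value `Δ_σ ≈ 0.518`): the barrier witness `ScaleNotMoebius.narrowFamily Δ` has
(H3)–(H6) and is not inversion covariant. Any proof must use the Ising lattice limit. [folklore] -/
theorem not_cruxWithoutIsingLimit {Δ : ℝ} (hΔ : 0 < Δ) : ¬ CruxWithoutIsingLimit Δ := fun h =>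
  ScaleNotMoebius.narrowFamily_not_isInversionCovariant hΔ
    (h _ (ScaleNotMoebius.narrowFamily_eq_zero_of_not_mem hΔ.ne')
      (ScaleNotMoebius.narrowFamily_isNondegenerateTwoPoint Δ)
      (ScaleNotMoebius.narrowFamily_isEuclideanInvariant Δ) (ScaleNotMoebius.narrowFamily_isScaleCovariant Δ))

/-- The crux with `criticalCorr 3` weakened to an ARBITRARY lattice family `G` ("generic lattice
provenance"). [folklore] -/
def CruxWithGenericLattice (Δ : ℝ) : Prop :=
  ∀ (G : LatticeCorrFamily 3) (ρ : ℝ → ℝ) (S : CorrFamily 3), (∀ δ ∈ Set.Ioc (0:ℝ) 1, 0 < ρ δ) →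
    HasPointwiseScalingLimit G ρ S → (∀ n z, z ∉ NonCoincident 3 n → S n z = 0) →
    IsNondegenerateTwoPoint S → IsEuclideanInvariant S → IsScaleCovariant Δ S → IsInversionCovariant Δ S

/-- **(H2) cannot be weakened to "`S` is a scale-covariant LATTICE scaling limit"** (cycle 1,
LANDED in the barrier file as `not_inversionUpgrade_of_latticeLimit_at`, p68577): `narrowFamily Δ`
is the pointwise limit of its own `ℤ³` sampling with `ρ δ = δ^{-Δ}`. The content of (H2) that a
proof may use is `criticalCorr 3`-SPECIFIC (random currents, Ward identities, reflection
positivity of ALL orders), not "being a lattice limit". [folklore] -/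
theorem not_cruxWithGenericLattice {Δ : ℝ} (hΔ : 0 < Δ) : ¬ CruxWithGenericLattice Δ :=
  not_inversionUpgrade_of_latticeLimit_at hΔ

/-- The crux with the NORMALISATION (H3) deleted (= item stmt-0637, the un-normalised (U)). [folklore] -/
def CruxWithoutNormalisation : Prop :=
  ∀ (ρ : ℝ → ℝ) (Δ : ℝ) (S : CorrFamily 3), (∀ δ ∈ Set.Ioc (0:ℝ) 1, 0 < ρ δ) →
    HasPointwiseScalingLimit (criticalCorr 3) ρ S → IsNondegenerateTwoPoint S →
    IsEuclideanInvariant S → IsScaleCovariant Δ S → IsInversionCovariant Δ S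

/-- **(H3) is load-bearing, given that the hypotheses are satisfiable at all** (the Euclidean
limit `CritIsing3DEuclideanLimit`, item 0638): tree refutation of stmt-0637 through values on the
partially coincident locus (`IsingEuclidUpgrade.not_inversionUpgrade_of_euclideanLimit`). [folklore] -/
theorem not_cruxWithoutNormalisation (hE : CritIsing3DEuclideanLimit) : ¬ CruxWithoutNormalisation :=
  Summit.CriticalPhenomena.IsingEuclidUpgrade.not_inversionUpgrade_of_euclideanLimit hE

/-- Normalising a family off `NonCoincident` keeps limit, non-degeneracy, Euclidean invariance and
scale covariance; so the Euclidean limit yields an instance of ALL hypotheses of the crux. [folklore] -/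
theorem exists_hyp_of_euclideanLimit (hE : CritIsing3DEuclideanLimit) :
    ∃ (ρ : ℝ → ℝ) (Δ : ℝ) (S : CorrFamily 3), Hyp ρ Δ S := by
  classical
  obtain ⟨ρ, Δ, S₀, hρ, _, hlim, hnd, heuc, hsc⟩ := hE
  let S : CorrFamily 3 := fun n z => if Function.Injective z then S₀ n z else 0
  have S_of_inj : ∀ {n : ℕ} {z : Fin n → EuclideanSpace ℝ (Fin 3)}, Function.Injective z → S n z = S₀ n z :=
    fun hz => by simp [S, hz]
  have S_of_not : ∀ {n : ℕ} {z : Fin n → EuclideanSpace ℝ (Fin 3)}, ¬ Function.Injective z → S n z = 0 :=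
    fun hz => by simp [S, hz]
  refine ⟨ρ, Δ, S, hρ, ?_, ?_, ?_, ?_, ?_⟩
  · exact fun n => (hlim n).congr_right fun z hz => (S_of_inj hz).symm
  · intro n z hz; exact S_of_not hz
  · intro z hz; rw [S_of_inj hz]; exact hnd z hz
  · refine ⟨fun n v z => ?_, fun n R z => ?_⟩
    · by_cases hz : Function.Injective z
      · have hz' : Function.Injective (fun i => z i + v) := (add_left_injective v).comp hz
        rw [S_of_inj hz, S_of_inj hz', heuc.1 n v z]
      · have hz' : ¬ Function.Injective (fun i => z i + v) :=
          fun h => hz ((add_left_injective v).of_comp_iff _ |>.1 h)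
        rw [S_of_not hz, S_of_not hz']
    · by_cases hz : Function.Injective z
      · have hz' : Function.Injective (fun i => R (z i)) := R.injective.comp hz
        rw [S_of_inj hz, S_of_inj hz', heuc.2 n R z]
      · have hz' : ¬ Function.Injective (fun i => R (z i)) :=
          fun h => hz (R.injective.of_comp_iff _ |>.1 h)
        rw [S_of_not hz, S_of_not hz']
  · intro n c hc z
    by_cases hz : Function.Injective z
    · have hz' : Function.Injective (fun i => c • z i) := (smul_right_injective _ hc.ne').comp hz
      rw [S_of_inj hz, S_of_inj hz', hsc n c hc z]
    · have hz' : ¬ Function.Injective (fun i => c • z i) :=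
        fun h => hz ((smul_right_injective _ hc.ne').of_comp_iff _ |>.1 h)
      rw [S_of_not hz, S_of_not hz', mul_zero]

/-- The crux with SCALE COVARIANCE (H6) deleted: `Δ` is then a free parameter of the conclusion. [folklore] -/
def CruxWithoutScaleCovariance : Prop :=
  ∀ (ρ : ℝ → ℝ) (Δ : ℝ) (S : CorrFamily 3), (∀ δ ∈ Set.Ioc (0:ℝ) 1, 0 < ρ δ) →
    HasPointwiseScalingLimit (criticalCorr 3) ρ S → (∀ n z, z ∉ NonCoincident 3 n → S n z = 0) →
    IsNondegenerateTwoPoint S → IsEuclideanInvariant S → IsInversionCovariant Δ S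

/-- The unit vector `e₀`. [folklore] -/
def e0 : EuclideanSpace ℝ (Fin 3) := EuclideanSpace.single 0 1

theorem norm_e0 : ‖e0‖ = 1 := by simp [e0]

theorem e0_ne_zero : e0 ≠ 0 := by
  rw [← norm_ne_zero_iff, norm_e0]; exact one_ne_zero

theorem two_smul_e0_ne_zero : (2:ℝ) • e0 ≠ 0 := smul_ne_zero two_ne_zero e0_ne_zero

theorem e0_ne_two_smul_e0 : e0 ≠ (2:ℝ) • e0 := by
  intro h
  have : (1:ℝ) • e0 = (2:ℝ) • e0 := by simpa using h
  exact absurd (smul_left_injective ℝ e0_ne_zero this) (by norm_num)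

/-- Inversion covariance with TWO different weights at `n = 2` contradicts non-degeneracy:
at `(e₀, 2e₀)` the two laws give `2^{2Δ} S₂ = 2^{2Δ'} S₂` with `S₂ > 0`. [folklore] -/
theorem weight_unique_of_two {Δ Δ' : ℝ} {S : CorrFamily 3} (hnd : IsNondegenerateTwoPoint S)
    (h : InvIdentityAt Δ S 2) (h' : InvIdentityAt Δ' S 2) : Δ = Δ' := by
  let x : Fin 2 → EuclideanSpace ℝ (Fin 3) := ![e0, (2:ℝ) • e0]
  have hx0 : ∀ i, x i ≠ 0 := by
    intro i; fin_cases i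
    · exact e0_ne_zero
    · exact two_smul_e0_ne_zero
  have hxinj : Function.Injective x := by
    intro i j hij
    fin_cases i <;> fin_cases j
    · rfl
    · exact absurd hij e0_ne_two_smul_e0
    · exact absurd hij.symm e0_ne_two_smul_e0
    · rfl
  have hpos : 0 < S 2 x := hnd x hxinj
  have hprod : (∏ i, ‖x i‖ ^ (2 * Δ)) = (2:ℝ) ^ (2 * Δ) := by
    simp [x, Fin.prod_univ_two, norm_smul, norm_e0]
  have hprod' : (∏ i, ‖x i‖ ^ (2 * Δ')) = (2:ℝ) ^ (2 * Δ') := by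
    simp [x, Fin.prod_univ_two, norm_smul, norm_e0]
  have h1 := h x hx0
  have h2 := h' x hx0
  rw [hprod] at h1
  rw [hprod'] at h2
  have heq : (2:ℝ) ^ (2 * Δ) = (2:ℝ) ^ (2 * Δ') := by
    have := h1.symm.trans h2
    exact mul_right_cancel₀ hpos.ne' this
  have := congrArg Real.log heq
  rw [Real.log_rpow two_pos, Real.log_rpow two_pos] at this
  have hlog : Real.log 2 ≠ 0 := by positivity
  have := mul_right_cancel₀ hlog this
  linarith

/-- **(H6) is load-bearing (it is what binds `Δ`), given satisfiability of the hypotheses**: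
without it the conclusion would hold for `Δ` and `Δ + 1` simultaneously. [folklore] -/
theorem not_cruxWithoutScaleCovariance (hE : CritIsing3DEuclideanLimit) : ¬ CruxWithoutScaleCovariance := by
  intro h
  obtain ⟨ρ, Δ, S, hh⟩ := exists_hyp_of_euclideanLimit hE
  have h1 := h ρ Δ S hh.rho_pos hh.lim hh.norm hh.nondeg hh.euclid
  have h2 := h ρ (Δ + 1) S hh.rho_pos hh.lim hh.norm hh.nondeg hh.euclid
  have := weight_unique_of_two hh.nondeg (h1 2) (h2 2)
  linarith

/-- (H1) up to sign: for the critical correlators the renormalisation enters only through `ρ(δ)ⁿ`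
with `n` even (odd orders vanish on `ℤ³`), so `ρ` and `|ρ|` give the same rescaled family. [folklore] -/
theorem rescaledCorrelator_abs (ρ : ℝ → ℝ) (n : ℕ) (δ : ℝ) (x : Fin n → EuclideanSpace ℝ (Fin 3)) :
    rescaledCorrelator (criticalCorr 3) (fun δ => |ρ δ|) n δ x = rescaledCorrelator (criticalCorr 3) ρ n δ x := by
  rw [rescaledCorrelator_apply, rescaledCorrelator_apply]
  rcases Nat.even_or_odd n with hev | hodd
  · rw [hev.pow_abs]
  · rw [criticalCorr_eq_zero_of_odd (d := 3) le_rfl hodd, mul_zero, mul_zero]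

/-- So (H2) is insensitive to the sign of `ρ`: the positivity half of (H1) carries no information
beyond `ρ δ ≠ 0`, which (H2)+(H4) force for small `δ` anyway. ("(H1) possibly unnecessary" —
information for the prover; the crux with (H1) deleted is not attackable either.) [folklore] -/
theorem hasPointwiseScalingLimit_abs_iff (ρ : ℝ → ℝ) (S : CorrFamily 3) :
    HasPointwiseScalingLimit (criticalCorr 3) (fun δ => |ρ δ|) S ↔ HasPointwiseScalingLimit (criticalCorr 3) ρ S := by
  have : rescaledCorrelator (criticalCorr 3) (fun δ => |ρ δ|) = rescaledCorrelator (criticalCorr 3) ρ := by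
    funext n δ x; exact rescaledCorrelator_abs ρ n δ x
  simp only [HasPointwiseScalingLimit, this]

/-! ## §4 Natural strengthenings of the CONCLUSION — refuted (the guards are tight) -/

/-- The conclusion WITHOUT the origin guard `∀ i, x i ≠ 0`. [folklore] -/
def UnguardedInversionCovariant (Δ : ℝ) (S : CorrFamily 3) : Prop :=
  ∀ n (x : Fin n → EuclideanSpace ℝ (Fin 3)),
    S n (fun i => inversion 0 1 (x i)) = (∏ i, ‖x i‖ ^ (2 * Δ)) * S n x

theorem inversion_e0 : inversion (0 : EuclideanSpace ℝ (Fin 3)) 1 e0 = e0 := by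
  simp [inversion, norm_e0]

/-- **The origin guard is necessary**: Mathlib's `inversion 0 1 0 = 0`, so at `(0, e₀)` the
unguarded law reads `S₂(0,e₀) = 0^{2Δ}·S₂(0,e₀) = 0`, contradicting non-degeneracy — for EVERY
non-degenerate family and every `Δ > 0` (in particular for the pinned Ising limit). [folklore] -/
theorem not_unguarded {Δ : ℝ} (hΔ : 0 < Δ) {S : CorrFamily 3} (hnd : IsNondegenerateTwoPoint S) :
    ¬ UnguardedInversionCovariant Δ S := by
  intro h
  let x : Fin 2 → EuclideanSpace ℝ (Fin 3) := ![0, e0]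
  have hxinj : Function.Injective x := by
    intro i j hij
    fin_cases i <;> fin_cases j
    · rfl
    · exact absurd hij (Ne.symm e0_ne_zero)
    · exact absurd hij e0_ne_zero
    · rfl
  have hpos : 0 < S 2 x := hnd x hxinj
  have hinv : (fun i => inversion (0 : EuclideanSpace ℝ (Fin 3)) 1 (x i)) = x := by
    funext i; fin_cases i
    · simp [x]
    · simp [x, inversion_e0]
  have hprod : (∏ i, ‖x i‖ ^ (2 * Δ)) = 0 := by
    rw [Fin.prod_univ_two]
    simp [x, Real.zero_rpow (by positivity : (2 * Δ) ≠ 0)]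
  have := h 2 x
  rw [hinv, hprod, zero_mul] at this
  exact absurd this hpos.ne'

/-- So the crux with the unguarded conclusion is FALSE as soon as its hypotheses are satisfiable. [folklore] -/
theorem not_cruxUnguarded (hE : CritIsing3DEuclideanLimit) :
    ¬ ∀ (ρ : ℝ → ℝ) (Δ : ℝ) (S : CorrFamily 3), Hyp ρ Δ S → UnguardedInversionCovariant Δ S := by
  intro h
  obtain ⟨ρ, Δ, S, hh⟩ := exists_hyp_of_euclideanLimit hE
  exact not_unguarded (delta_pos hh) hh.nondeg (h ρ Δ S hh)

/-- **The weight of the conclusion is forced**: under (H4)+(H5)+(H6) (model-blind) the only weight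
`Δ'` for which `S` can be inversion covariant is `Δ' = Δ` — the conclusion cannot be strengthened or
shifted to another exponent, and a line proving covariance "for some weight" proves it for `Δ`. [folklore] -/
theorem inversion_weight_eq {Δ Δ' : ℝ} {S : CorrFamily 3}
    (hnorm : ∀ n z, z ∉ NonCoincident 3 n → S n z = 0) (hnd : IsNondegenerateTwoPoint S)
    (heuc : IsEuclideanInvariant S) (hsc : IsScaleCovariant Δ S) (hinv : IsInversionCovariant Δ' S) :
    Δ' = Δ :=
  (weight_unique_of_two hnd (invIdentityAt_two hnorm heuc hsc) (hinv 2)).symm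


/-! ## §5 Reflection MONOTONICITY (MMS / Hegerfeldt–Schrader shape) is inside the blocked class

Cycle 2. Cards `inversion-defect-involution` (input #1) and `circumsphere-robin-law` (the "MMS sign")
propose to feed the one-sided inequality / the Robin slope with reflection monotonicity of spin
products in all planes. Triage-2 (job j007224) found numerically that `narrowFamily Δ` already has
this monotonicity at `n ≤ 4`. Here it is a THEOREM for `Δ ≥ 1/2`, all orders, all splits. -/

/-- Pointwise derivative bound behind the reflection monotonicity of `narrowFamily`:
for `α ≥ 1`, `0 < w`, `0 < u`, `2w² ≤ K`: `4u (2u² + K)^{-(α+1)} ≤ w^{-α} u^{-(α+1)}`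
(via `M = max u w`: `4 u^{α+2} w^α ≤ 4 M^{2α+2} ≤ (2M²)^{α+1} ≤ (2u² + K)^{α+1}`). [folklore] -/
theorem core_deriv_bound {α w u K : ℝ} (hα : 1 ≤ α) (hw : 0 < w) (hu : 0 < u) (hK : 2 * w ^ 2 ≤ K) :
    4 * u * (2 * u ^ 2 + K) ^ (-(α + 1)) ≤ w ^ (-α) * u ^ (-(α + 1)) := by
  have hX : 0 < 2 * u ^ 2 + K := by nlinarith
  -- reduce to `4 u^{α+2} w^α ≤ (2u²+K)^{α+1}`
  rw [Real.rpow_neg hX.le, Real.rpow_neg hw.le, Real.rpow_neg hu.le]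
  rw [show 4 * u * ((2 * u ^ 2 + K) ^ (α + 1))⁻¹ = (4 * u) / (2 * u ^ 2 + K) ^ (α + 1) by ring,
    show (w ^ α)⁻¹ * (u ^ (α + 1))⁻¹ = 1 / (w ^ α * u ^ (α + 1)) by ring]
  rw [div_le_div_iff₀ (by positivity) (by positivity), one_mul]
  -- M := max u w
  set M := max u w with hM
  have hM0 : 0 < M := lt_max_of_lt_left hu
  have huM : u ≤ M := le_max_left _ _
  have hwM : w ≤ M := le_max_right _ _
  have h1 : 4 * u * (w ^ α * u ^ (α + 1)) ≤ 4 * M ^ (2 * α + 2) := by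
    have e1 : u ^ (α + 1) ≤ M ^ (α + 1) := Real.rpow_le_rpow hu.le huM (by linarith)
    have e2 : w ^ α ≤ M ^ α := Real.rpow_le_rpow hw.le hwM (by linarith)
    have e3 : M ^ (2 * α + 2) = M * (M ^ α * M ^ (α + 1)) := by
      rw [← Real.rpow_add hM0, show 2 * α + 2 = 1 + (α + (α + 1)) by ring, Real.rpow_add hM0,
        Real.rpow_one]
    rw [e3]
    have : w ^ α * u ^ (α + 1) ≤ M ^ α * M ^ (α + 1) :=
      mul_le_mul e2 e1 (by positivity) (by positivity)
    nlinarith [this, mul_nonneg (by positivity : (0:ℝ) ≤ M ^ α) (by positivity : (0:ℝ) ≤ M ^ (α + 1))]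
  have h2 : 4 * M ^ (2 * α + 2) ≤ (2 * M ^ 2) ^ (α + 1) := by
    rw [Real.mul_rpow (by norm_num) (by positivity), ← Real.rpow_natCast M 2, ← Real.rpow_mul hM0.le]
    push_cast
    rw [show (2 : ℝ) * (α + 1) = 2 * α + 2 by ring]
    have h4 : (4 : ℝ) ≤ 2 ^ (α + 1) := by
      calc (4 : ℝ) = 2 ^ ((2 : ℕ) : ℝ) := by rw [Real.rpow_natCast]; norm_num
        _ ≤ 2 ^ (α + 1) := Real.rpow_le_rpow_of_exponent_le (by norm_num) (by push_cast; linarith)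
    exact mul_le_mul_of_nonneg_right h4 (by positivity)
  have h3 : (2 * M ^ 2) ^ (α + 1) ≤ (2 * u ^ 2 + K) ^ (α + 1) := by
    refine Real.rpow_le_rpow (by positivity) ?_ (by linarith)
    have : M ^ 2 ≤ u ^ 2 + w ^ 2 := by
      rcases le_total u w with h | h
      · rw [hM, max_eq_right h]; nlinarith
      · rw [hM, max_eq_left h]; nlinarith
    nlinarith
  linarith

/-- The one-variable function `g(v) = w^{-α} v^{-α} - (2v² + K)^{-α}` is antitone on `(0,∞)`
for `α ≥ 1`, `2w² ≤ K` (mean value theorem, `core_deriv_bound`). [folklore] -/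
theorem core_antitoneOn {α w K : ℝ} (hα : 1 ≤ α) (hw : 0 < w) (hK : 2 * w ^ 2 ≤ K) :
    AntitoneOn (fun v : ℝ => w ^ (-α) * v ^ (-α) - (2 * v ^ 2 + K) ^ (-α)) (Ioi 0) := by
  have hKpos : 0 < K := by nlinarith
  refine antitoneOn_of_hasDerivWithinAt_nonpos (convex_Ioi 0)
    (f' := fun v => w ^ (-α) * ((-α) * v ^ (-α - 1)) - (4 * v) * (-α) * (2 * v ^ 2 + K) ^ (-α - 1)) ?_ ?_ ?_
  · -- continuity on Ioi 0
    intro v hv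
    have hv' : (0:ℝ) < v := hv
    refine ContinuousAt.continuousWithinAt ?_
    have hX : 2 * v ^ 2 + K ≠ 0 := by nlinarith
    refine ((continuousAt_const.mul (Real.continuousAt_rpow_const _ _ (Or.inl hv'.ne'))).sub ?_)
    exact (Real.continuousAt_rpow_const _ _ (Or.inl hX)).comp
      (f := fun v : ℝ => 2 * v ^ 2 + K) (by fun_prop)
  · intro v hv
    rw [interior_Ioi] at hv
    have hv' : (0:ℝ) < v := hv
    have hX : 2 * v ^ 2 + K ≠ 0 := by nlinarith
    have h1 : HasDerivAt (fun v : ℝ => v ^ (-α)) ((-α) * v ^ (-α - 1)) v :=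
      Real.hasDerivAt_rpow_const (Or.inl hv'.ne')
    have h2 : HasDerivAt (fun v : ℝ => 2 * v ^ 2 + K) (4 * v) v := by
      have := ((hasDerivAt_pow 2 v).const_mul 2).add_const K
      refine this.congr_deriv ?_
      push_cast
      ring
    have h3 : HasDerivAt (fun v : ℝ => (2 * v ^ 2 + K) ^ (-α)) ((4 * v) * (-α) * (2 * v ^ 2 + K) ^ (-α - 1)) v :=
      h2.rpow_const (Or.inl hX)
    exact ((h1.const_mul _).sub h3).hasDerivWithinAt
  · intro v hv
    rw [interior_Ioi] at hv
    have hv' : (0:ℝ) < v := hv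
    have hb := core_deriv_bound hα hw hv' hK
    have hα0 : 0 < α := by linarith
    rw [show -α - 1 = -(α + 1) by ring]
    nlinarith [hb, hα0]

/-- Two-point consequence used coordinatewise: for `0 < u ≤ u'`,
`w^{-α} u'^{-α} - (2u'² + K)^{-α} ≤ w^{-α} u^{-α} - (2u² + K)^{-α}`. [folklore] -/
theorem core_step {α w u u' K : ℝ} (hα : 1 ≤ α) (hw : 0 < w) (hu : 0 < u) (huu' : u ≤ u') (hK : 2 * w ^ 2 ≤ K) :
    w ^ (-α) * u' ^ (-α) - (2 * u' ^ 2 + K) ^ (-α) ≤ w ^ (-α) * u ^ (-α) - (2 * u ^ 2 + K) ^ (-α) :=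
  core_antitoneOn hα hw hK hu (lt_of_lt_of_le hu huu') huu'

/-- The four-point function of `narrowFamily` as a function of the six mutual distances
`(d₀₁, d₀₂, d₀₃, d₁₂, d₁₃, d₂₃)` (exponent `α = 2Δ`). [folklore] -/
def G4 (α : ℝ) (d01 d02 d03 d12 d13 d23 : ℝ) : ℝ :=
  d01 ^ (-α) * d23 ^ (-α) + d02 ^ (-α) * d13 ^ (-α) + d03 ^ (-α) * d12 ^ (-α)
    - (2 * (d01 ^ 2 + d02 ^ 2 + d03 ^ 2 + d12 ^ 2 + d13 ^ 2 + d23 ^ 2)) ^ (-α)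

/-- `sqSum` over ordered pairs is twice the sum over the six unordered pairs. [folklore] -/
theorem sqSum_eq (x : Fin 4 → EuclideanSpace ℝ (Fin 3)) :
    sqSum x = 2 * (‖x 0 - x 1‖ ^ 2 + ‖x 0 - x 2‖ ^ 2 + ‖x 0 - x 3‖ ^ 2 + ‖x 1 - x 2‖ ^ 2 +
      ‖x 1 - x 3‖ ^ 2 + ‖x 2 - x 3‖ ^ 2) := by
  simp only [sqSum, Fin.sum_univ_four, sub_self, norm_zero]
  rw [norm_sub_rev (x 1) (x 0), norm_sub_rev (x 2) (x 0), norm_sub_rev (x 3) (x 0),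
    norm_sub_rev (x 2) (x 1), norm_sub_rev (x 3) (x 1), norm_sub_rev (x 3) (x 2)]
  ring

/-- `narrowFamily Δ 4 = G4 (2Δ)` of the six distances, on non-coincident configurations. [folklore] -/
theorem narrowFamily_four_eq_G4 (Δ : ℝ) {x : Fin 4 → EuclideanSpace ℝ (Fin 3)} (hx : Injective x) :
    narrowFamily Δ 4 x = G4 (2 * Δ) ‖x 0 - x 1‖ ‖x 0 - x 2‖ ‖x 0 - x 3‖ ‖x 1 - x 2‖ ‖x 1 - x 3‖ ‖x 2 - x 3‖ := by
  rw [narrowFamily_four_of_injective Δ hx, wick, bump, sqSum_eq]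
  simp only [twoPt, G4]

/-- **Coordinatewise antitonicity of `G4` for `α ≥ 1`**: increasing the six distances (weakly,
independently) can only decrease `G4`. Six applications of `core_step`, one per distance, the
complementary distance playing the role of `w`. [folklore] -/
theorem G4_mono {α : ℝ} (hα : 1 ≤ α) {a1 a2 a3 a4 a5 a6 b1 b2 b3 b4 b5 b6 : ℝ}
    (h1 : 0 < a1) (h2 : 0 < a2) (h3 : 0 < a3) (h4 : 0 < a4) (h5 : 0 < a5) (h6 : 0 < a6)
    (l1 : a1 ≤ b1) (l2 : a2 ≤ b2) (l3 : a3 ≤ b3) (l4 : a4 ≤ b4) (l5 : a5 ≤ b5) (l6 : a6 ≤ b6) :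
    G4 α b1 b2 b3 b4 b5 b6 ≤ G4 α a1 a2 a3 a4 a5 a6 := by
  have hb1 : 0 < b1 := lt_of_lt_of_le h1 l1
  have hb2 : 0 < b2 := lt_of_lt_of_le h2 l2
  have hb3 : 0 < b3 := lt_of_lt_of_le h3 l3
  have hb4 : 0 < b4 := lt_of_lt_of_le h4 l4
  have hb5 : 0 < b5 := lt_of_lt_of_le h5 l5
  -- step 1: coordinate 1 (pair 01, complement 23 = coordinate 6)
  have s1 : G4 α b1 a2 a3 a4 a5 a6 ≤ G4 α a1 a2 a3 a4 a5 a6 := by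
    have c := core_step (K := 2 * (a2 ^ 2 + a3 ^ 2 + a4 ^ 2 + a5 ^ 2 + a6 ^ 2)) hα h6 h1 l1 (by linarith [sq_nonneg a2, sq_nonneg a3, sq_nonneg a4, sq_nonneg a5])
    simp only [G4]
    rw [show 2 * (b1 ^ 2 + a2 ^ 2 + a3 ^ 2 + a4 ^ 2 + a5 ^ 2 + a6 ^ 2)
        = 2 * b1 ^ 2 + 2 * (a2 ^ 2 + a3 ^ 2 + a4 ^ 2 + a5 ^ 2 + a6 ^ 2) by ring,
      show 2 * (a1 ^ 2 + a2 ^ 2 + a3 ^ 2 + a4 ^ 2 + a5 ^ 2 + a6 ^ 2)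
        = 2 * a1 ^ 2 + 2 * (a2 ^ 2 + a3 ^ 2 + a4 ^ 2 + a5 ^ 2 + a6 ^ 2) by ring]
    linarith [c]
  -- step 2: coordinate 2 (pair 02, complement 13 = coordinate 5)
  have s2 : G4 α b1 b2 a3 a4 a5 a6 ≤ G4 α b1 a2 a3 a4 a5 a6 := by
    have c := core_step (K := 2 * (b1 ^ 2 + a3 ^ 2 + a4 ^ 2 + a5 ^ 2 + a6 ^ 2)) hα h5 h2 l2 (by linarith [sq_nonneg b1, sq_nonneg a3, sq_nonneg a4, sq_nonneg a6])
    simp only [G4]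
    rw [show 2 * (b1 ^ 2 + b2 ^ 2 + a3 ^ 2 + a4 ^ 2 + a5 ^ 2 + a6 ^ 2)
        = 2 * b2 ^ 2 + 2 * (b1 ^ 2 + a3 ^ 2 + a4 ^ 2 + a5 ^ 2 + a6 ^ 2) by ring,
      show 2 * (b1 ^ 2 + a2 ^ 2 + a3 ^ 2 + a4 ^ 2 + a5 ^ 2 + a6 ^ 2)
        = 2 * a2 ^ 2 + 2 * (b1 ^ 2 + a3 ^ 2 + a4 ^ 2 + a5 ^ 2 + a6 ^ 2) by ring]
    linarith [c]
  -- step 3: coordinate 3 (pair 03, complement 12 = coordinate 4)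
  have s3 : G4 α b1 b2 b3 a4 a5 a6 ≤ G4 α b1 b2 a3 a4 a5 a6 := by
    have c := core_step (K := 2 * (b1 ^ 2 + b2 ^ 2 + a4 ^ 2 + a5 ^ 2 + a6 ^ 2)) hα h4 h3 l3 (by linarith [sq_nonneg b1, sq_nonneg b2, sq_nonneg a5, sq_nonneg a6])
    simp only [G4]
    rw [show 2 * (b1 ^ 2 + b2 ^ 2 + b3 ^ 2 + a4 ^ 2 + a5 ^ 2 + a6 ^ 2)
        = 2 * b3 ^ 2 + 2 * (b1 ^ 2 + b2 ^ 2 + a4 ^ 2 + a5 ^ 2 + a6 ^ 2) by ring,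
      show 2 * (b1 ^ 2 + b2 ^ 2 + a3 ^ 2 + a4 ^ 2 + a5 ^ 2 + a6 ^ 2)
        = 2 * a3 ^ 2 + 2 * (b1 ^ 2 + b2 ^ 2 + a4 ^ 2 + a5 ^ 2 + a6 ^ 2) by ring]
    linarith [c]
  -- step 4: coordinate 4 (pair 12, complement 03 = coordinate 3, now b3)
  have s4 : G4 α b1 b2 b3 b4 a5 a6 ≤ G4 α b1 b2 b3 a4 a5 a6 := by
    have c := core_step (K := 2 * (b1 ^ 2 + b2 ^ 2 + b3 ^ 2 + a5 ^ 2 + a6 ^ 2)) hα hb3 h4 l4 (by linarith [sq_nonneg b1, sq_nonneg b2, sq_nonneg a5, sq_nonneg a6])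
    simp only [G4]
    rw [show 2 * (b1 ^ 2 + b2 ^ 2 + b3 ^ 2 + b4 ^ 2 + a5 ^ 2 + a6 ^ 2)
        = 2 * b4 ^ 2 + 2 * (b1 ^ 2 + b2 ^ 2 + b3 ^ 2 + a5 ^ 2 + a6 ^ 2) by ring,
      show 2 * (b1 ^ 2 + b2 ^ 2 + b3 ^ 2 + a4 ^ 2 + a5 ^ 2 + a6 ^ 2)
        = 2 * a4 ^ 2 + 2 * (b1 ^ 2 + b2 ^ 2 + b3 ^ 2 + a5 ^ 2 + a6 ^ 2) by ring]
    linarith [c]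
  -- step 5: coordinate 5 (pair 13, complement 02 = coordinate 2, now b2)
  have s5 : G4 α b1 b2 b3 b4 b5 a6 ≤ G4 α b1 b2 b3 b4 a5 a6 := by
    have c := core_step (K := 2 * (b1 ^ 2 + b2 ^ 2 + b3 ^ 2 + b4 ^ 2 + a6 ^ 2)) hα hb2 h5 l5 (by linarith [sq_nonneg b1, sq_nonneg b3, sq_nonneg b4, sq_nonneg a6])
    simp only [G4]
    rw [show 2 * (b1 ^ 2 + b2 ^ 2 + b3 ^ 2 + b4 ^ 2 + b5 ^ 2 + a6 ^ 2)
        = 2 * b5 ^ 2 + 2 * (b1 ^ 2 + b2 ^ 2 + b3 ^ 2 + b4 ^ 2 + a6 ^ 2) by ring,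
      show 2 * (b1 ^ 2 + b2 ^ 2 + b3 ^ 2 + b4 ^ 2 + a5 ^ 2 + a6 ^ 2)
        = 2 * a5 ^ 2 + 2 * (b1 ^ 2 + b2 ^ 2 + b3 ^ 2 + b4 ^ 2 + a6 ^ 2) by ring]
    linarith [c]
  -- step 6: coordinate 6 (pair 23, complement 01 = coordinate 1, now b1)
  have s6 : G4 α b1 b2 b3 b4 b5 b6 ≤ G4 α b1 b2 b3 b4 b5 a6 := by
    have c := core_step (K := 2 * (b1 ^ 2 + b2 ^ 2 + b3 ^ 2 + b4 ^ 2 + b5 ^ 2)) hα hb1 h6 l6 (by linarith [sq_nonneg b2, sq_nonneg b3, sq_nonneg b4, sq_nonneg b5])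
    simp only [G4]
    rw [show 2 * (b1 ^ 2 + b2 ^ 2 + b3 ^ 2 + b4 ^ 2 + b5 ^ 2 + b6 ^ 2)
        = 2 * b6 ^ 2 + 2 * (b1 ^ 2 + b2 ^ 2 + b3 ^ 2 + b4 ^ 2 + b5 ^ 2) by ring,
      show 2 * (b1 ^ 2 + b2 ^ 2 + b3 ^ 2 + b4 ^ 2 + b5 ^ 2 + a6 ^ 2)
        = 2 * a6 ^ 2 + 2 * (b1 ^ 2 + b2 ^ 2 + b3 ^ 2 + b4 ^ 2 + b5 ^ 2) by ring]
    linarith [c]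
  exact s6.trans (s5.trans (s4.trans (s3.trans (s2.trans s1))))

/-- **Distance domination** (`Δ ≥ 1/2`): if every mutual distance of `y` is at least the
corresponding one of an injective `x`, then `narrowFamily Δ n y ≤ narrowFamily Δ n x`. [folklore] -/
theorem narrowFamily_le_of_dist_le {Δ : ℝ} (hΔ : 1 / 2 ≤ Δ) {n : ℕ}
    {x y : Fin n → EuclideanSpace ℝ (Fin 3)} (hx : Injective x)
    (h : ∀ i j, ‖x i - x j‖ ≤ ‖y i - y j‖) : narrowFamily Δ n y ≤ narrowFamily Δ n x := by
  -- `y` is injective too, and the distances of `x` are positive off the diagonal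
  have hy : Injective y := by
    intro i j hij
    by_contra hne
    have h1 : 0 < ‖x i - x j‖ := norm_pos_iff.2 (sub_ne_zero.2 (hx.ne hne))
    have h2 : ‖y i - y j‖ = 0 := by rw [hij, sub_self, norm_zero]
    linarith [h i j]
  have hd : ∀ i j : Fin n, i ≠ j → 0 < ‖x i - x j‖ := fun i j hij =>
    norm_pos_iff.2 (sub_ne_zero.2 (hx.ne hij))
  clear hx
  match n, x, y, hy, h, hd with
  | 0, _, _, _, _, _ => simp [narrowFamily_zero]
  | 1, _, _, _, _, _ => exact le_refl _
  | 2, x, y, _, h, hd =>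
    rw [narrowFamily_two, narrowFamily_two, twoPt, twoPt]
    exact Real.rpow_le_rpow_of_nonpos (hd 0 1 (by decide)) (h 0 1) (by linarith)
  | 3, _, _, _, _, _ => exact le_refl _
  | 4, x, y, hy, h, hd =>
    have hx : Injective x := by
      intro i j hij
      by_contra hne
      have := hd i j hne
      rw [hij, sub_self, norm_zero] at this
      exact lt_irrefl _ this
    rw [narrowFamily_four_eq_G4 Δ hx, narrowFamily_four_eq_G4 Δ hy]
    exact G4_mono (by linarith) (hd 0 1 (by decide)) (hd 0 2 (by decide)) (hd 0 3 (by decide))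
      (hd 1 2 (by decide)) (hd 1 3 (by decide)) (hd 2 3 (by decide))
      (h 0 1) (h 0 2) (h 0 3) (h 1 2) (h 1 3) (h 2 3)
  | (n + 5), _, _, _, _, _ => exact le_refl _

/-- Reflecting one of two points of the open half-space `{x_τ > 0}` in the mirror `{x_τ = 0}`
does not decrease their distance: `‖a - b‖ ≤ ‖a - θ_τ b‖`. [folklore] -/
theorem norm_sub_le_norm_sub_axisReflection {τ : Fin 3} {a b : EuclideanSpace ℝ (Fin 3)}
    (ha : 0 < a τ) (hb : 0 < b τ) : ‖a - b‖ ≤ ‖a - axisReflection τ b‖ := by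
  rw [EuclideanSpace.norm_eq, EuclideanSpace.norm_eq]
  refine Real.sqrt_le_sqrt (Finset.sum_le_sum fun i _ => ?_)
  simp only [PiLp.sub_apply, axisReflection_apply, Real.norm_eq_abs, sq_abs]
  split_ifs with hi
  · subst hi; nlinarith
  · exact le_refl _

/-- **Reflection monotonicity of spin-type correlations in the mirror `{x_τ = 0}`**
(Messager–Miracle-Solé 1977 / Hegerfeldt 1977 / Schrader 1977 shape, continuum and pointwise):
for configurations `a` and `b` of the open half-space `{x_τ > 0}` with `a ⊔ b` non-coincident,
`S (a ⊔ θ_τ b) ≤ S (a ⊔ b)`. [cite: MessagerMiracleSoleJSP1977, Thm. 1] -/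
def IsReflectionMonotoneAlong (τ : Fin 3) (S : CorrFamily 3) : Prop :=
  ∀ (m k : ℕ) (a : Fin m → EuclideanSpace ℝ (Fin 3)) (b : Fin k → EuclideanSpace ℝ (Fin 3)),
    (∀ i, 0 < a i τ) → (∀ j, 0 < b j τ) → Injective (Fin.append a b) →
    S (m + k) (Fin.append a (fun j => axisReflection τ (b j))) ≤ S (m + k) (Fin.append a b)

/-- **The barrier witness is reflection MONOTONE in every coordinate mirror** (`Δ ≥ 1/2`, all
orders, all splits): reflecting part of a half-space configuration fixes the distances inside each
part and increases the cross distances, and `narrowFamily Δ` is antitone in the distances. [folklore] -/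
theorem narrowFamily_isReflectionMonotoneAlong {Δ : ℝ} (hΔ : 1 / 2 ≤ Δ) (τ : Fin 3) :
    IsReflectionMonotoneAlong τ (narrowFamily Δ) := by
  intro m k a b ha hb hinj
  refine narrowFamily_le_of_dist_le hΔ hinj fun i j => ?_
  refine Fin.addCases (fun i' => ?_) (fun i' => ?_) i <;> refine Fin.addCases (fun j' => ?_) (fun j' => ?_) j
  · simp only [Fin.append_left]; exact le_refl _
  · simp only [Fin.append_left, Fin.append_right]
    exact norm_sub_le_norm_sub_axisReflection (ha i') (hb j')
  · simp only [Fin.append_left, Fin.append_right]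
    rw [norm_sub_rev, norm_sub_rev (axisReflection τ (b i')) (a j')]
    exact norm_sub_le_norm_sub_axisReflection (ha j') (hb i')
  · simp only [Fin.append_right, ← map_sub, LinearIsometryEquiv.norm_map]
    exact le_refl _

/-! ### The barrier witness is not reflection positive (OS) along any axis -/

/-- `S₄ > 0` at every non-coincident configuration (`Δ ≥ 0`): Griffiths-II lower bound by a
Wick term, which is a product of two positive `twoPt`. [folklore] -/
theorem narrowFamily_four_pos {Δ : ℝ} (hΔ : 0 ≤ Δ) {x : Fin 4 → EuclideanSpace ℝ (Fin 3)}
    (hx : Injective x) : 0 < narrowFamily Δ 4 x := by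
  have h := (narrowFamily_griffithsII hΔ x hx).1
  have h01 : 0 < narrowFamily Δ 2 ![x 0, x 1] := by
    rw [narrowFamily_two]
    exact twoPt_pos Δ (hx.ne (show (0 : Fin 4) ≠ 1 by decide))
  have h23 : 0 < narrowFamily Δ 2 ![x 2, x 3] := by
    rw [narrowFamily_two]
    exact twoPt_pos Δ (hx.ne (show (2 : Fin 4) ≠ 3 by decide))
  exact lt_of_lt_of_le (mul_pos h01 h23) h

/-- Three points `e_τ, 2e_τ, 3e_τ` of the open half-space `{x_τ > 0}`. [folklore] -/
def cfgA (τ : Fin 3) : HalfSpaceConfig 3 τ where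
  n := 3
  pts := fun i => EuclideanSpace.single τ (((i : ℕ) : ℝ) + 1)
  injective := by
    intro i j hij
    have h : ((i : ℕ) : ℝ) + 1 = ((j : ℕ) : ℝ) + 1 := by
      simpa using congrArg (fun z : EuclideanSpace ℝ (Fin 3) => z τ) hij
    exact Fin.ext (Nat.cast_injective (R := ℝ) (by linarith))
  pos := fun i => by simp; positivity

/-- The point `4e_τ`. [folklore] -/
def cfgB (τ : Fin 3) : HalfSpaceConfig 3 τ where
  n := 1
  pts := fun _ => EuclideanSpace.single τ 4
  injective := Function.injective_of_subsingleton _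
  pos := fun i => by simp

/-- **`narrowFamily Δ` is NOT reflection positive** along any coordinate axis (`Δ ≥ 0`): in the
OS Gram matrix of the two vectors "three spins at `e_τ,2e_τ,3e_τ`" and "one spin at `4e_τ`" the
diagonal entry `S₆ ≡ 0` vanishes while the off-diagonal entries `S₄ > 0` do not — impossible for a
positive semidefinite matrix (OS Cauchy–Schwarz). So the model-blind no-go class of
`ScaleCovarianceNotMoebiusNarrow` (incl. reflection MONOTONICITY, above) is disjoint from OS
positivity: a proof of the crux can still run through RP of ALL orders. [folklore] -/
theorem narrowFamily_not_reflectionPositive {Δ : ℝ} (hΔ : 0 ≤ Δ) (τ : Fin 3) :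
    ¬ IsReflectionPositiveAlong τ (narrowFamily Δ) := by
  intro hRP
  have hAA : osPointKernel (narrowFamily Δ) (cfgA τ) (cfgA τ) = 0 := rfl
  have hAB : 0 < osPointKernel (narrowFamily Δ) (cfgA τ) (cfgB τ) :=
    narrowFamily_four_pos hΔ (osPointKernel_arg_injective (cfgA τ) (cfgB τ))
  have hBA : 0 < osPointKernel (narrowFamily Δ) (cfgB τ) (cfgA τ) :=
    narrowFamily_four_pos hΔ (osPointKernel_arg_injective (cfgB τ) (cfgA τ))
  have hBB : 0 < osPointKernel (narrowFamily Δ) (cfgB τ) (cfgB τ) := by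
    have hinj := osPointKernel_arg_injective (cfgB τ) (cfgB τ)
    show 0 < narrowFamily Δ 2 _
    rw [narrowFamily_two]
    exact twoPt_pos Δ (hinj.ne (show (0 : Fin 2) ≠ 1 by decide))
  set s := osPointKernel (narrowFamily Δ) (cfgA τ) (cfgB τ) with hs
  set s' := osPointKernel (narrowFamily Δ) (cfgB τ) (cfgA τ) with hs'
  set t := osPointKernel (narrowFamily Δ) (cfgB τ) (cfgB τ) with ht
  have key := hRP 2 ![cfgA τ, cfgB τ] ![t, -(s + s') / 2]
  simp only [Fin.sum_univ_two, Matrix.cons_val_zero, Matrix.cons_val_one] at key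
  rw [hAA, ← hs, ← hs', ← ht] at key
  nlinarith [mul_pos hBB (mul_pos (add_pos hAB hBA) (add_pos hAB hBA))]


/-! ## §5' Headline no-go of cycle 2 -/

/-- **No inversion upgrade from reflection monotonicity** (model-blind, every `Δ ≥ 1/2`, hence on
the whole Ising window): properties (1)–(13) of `ScaleCovarianceNotMoebiusNarrow` TOGETHER WITH
reflection monotonicity of all orders in the three coordinate mirrors (hence, by (2), in every
mirror of `ℝ³`) do not imply `IsInversionCovariant Δ`. Witness: `narrowFamily Δ`. So the
Messager–Miracle-Solé / Schrader inequalities of the Ising model, passed to the limit, cannot carry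
the conformal weight: a line built on `OneSidedInversion`/Robin must spend OS positivity of all
orders, the random-current form of `U₄`, or lattice identities. [folklore] -/
theorem not_inversionUpgrade_of_reflectionMonotone {Δ : ℝ} (hΔ : 1 / 2 ≤ Δ) :
    ¬ ∀ S : CorrFamily 3, IsNondegenerateTwoPoint S → IsEuclideanInvariant S →
      IsScaleCovariant Δ S → HasNontrivialU4 S → (∀ n x, 0 ≤ S n x) →
      (∀ n, Odd n → ∀ x, S n x = 0) → (∀ x, S 0 x = 1) →
      (∀ n (σ : Equiv.Perm (Fin n)) x, S n (x ∘ σ) = S n x) →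
      (∀ n x, x ∉ NonCoincident 3 n → S n x = 0) →
      (∀ x ∈ NonCoincident 3 4,
        S 2 ![x 0, x 1] * S 2 ![x 2, x 3] ≤ S 4 x ∧ S 2 ![x 0, x 2] * S 2 ![x 1, x 3] ≤ S 4 x ∧
          S 2 ![x 0, x 3] * S 2 ![x 1, x 2] ≤ S 4 x) →
      (∀ x, limitConnectedFour S x ≤ 0) →
      (∀ x ∈ NonCoincident 3 4, limitConnectedFour S x < 0) →
      (∀ x ∈ NonCoincident 3 4, ∀ i j : Fin 4, i ≠ j →
        |limitConnectedFour S x| ≤ S 2 ![x i, x j] ^ 2) →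
      (∀ τ : Fin 3, IsReflectionMonotoneAlong τ S) →
      IsInversionCovariant Δ S := by
  intro h
  have hΔ0 : 0 < Δ := by linarith
  exact narrowFamily_not_isInversionCovariant hΔ0 (h (narrowFamily Δ)
    (narrowFamily_isNondegenerateTwoPoint Δ) (narrowFamily_isEuclideanInvariant Δ)
    (narrowFamily_isScaleCovariant Δ) (narrowFamily_hasNontrivialU4 Δ) (narrowFamily_nonneg hΔ0.le)
    (fun _ hn x => narrowFamily_odd Δ hn x) (narrowFamily_zero Δ) (narrowFamily_perm Δ)
    (narrowFamily_eq_zero_of_not_mem hΔ0.ne') (narrowFamily_griffithsII hΔ0.le)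
    (limitConnectedFour_narrowFamily_nonpos Δ) (limitConnectedFour_narrowFamily_neg Δ)
    (fun x hx _ _ hij => abs_limitConnectedFour_narrowFamily_le hΔ0.le x hx hij)
    (fun τ => narrowFamily_isReflectionMonotoneAlong hΔ τ))

/-- The same, in the shape of the crux with (H1)+(H2) replaced by reflection monotonicity
(so: even "MMS in all mirrors" is not a substitute for the lattice clause). [folklore] -/
theorem not_cruxWithReflectionMonotone {Δ : ℝ} (hΔ : 1 / 2 ≤ Δ) :
    ¬ ∀ S : CorrFamily 3, (∀ n z, z ∉ NonCoincident 3 n → S n z = 0) → IsNondegenerateTwoPoint S →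
      IsEuclideanInvariant S → IsScaleCovariant Δ S → (∀ τ : Fin 3, IsReflectionMonotoneAlong τ S) →
      IsInversionCovariant Δ S := by
  intro h
  have hΔ0 : 0 < Δ := by linarith
  exact narrowFamily_not_isInversionCovariant hΔ0 (h (narrowFamily Δ)
    (narrowFamily_eq_zero_of_not_mem hΔ0.ne') (narrowFamily_isNondegenerateTwoPoint Δ)
    (narrowFamily_isEuclideanInvariant Δ) (narrowFamily_isScaleCovariant Δ)
    (fun τ => narrowFamily_isReflectionMonotoneAlong hΔ τ))

/-! ## §6' RP is outside the blocked class (complement to §6) -/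

/-- The no-go witness has NO OS Hilbert space along any axis; every line whose objects are built by
OS reconstruction (light-cone-hsm-special-conformal, PositivityBegetsConformality, ModularBoosts)
is untouched by §3–§5. [folklore] -/
theorem narrowFamily_not_reflectionPositive_all {Δ : ℝ} (hΔ : 0 ≤ Δ) :
    ∀ τ : Fin 3, ¬ IsReflectionPositiveAlong τ (narrowFamily Δ) :=
  fun τ => narrowFamily_not_reflectionPositive hΔ τ


/-! ## §7 Four-point covariance does NOT propagate (PROVED; tree `Negative/SixPointWitness.lean` + `SixPoint.lean`) -/

namespace SixPt

/-! ## The covariant non-Gaussian four-point connected part `harm` -/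

/-- The three Wick products of a four-point configuration. [folklore] -/
def W1 (Δ : ℝ) (x : Fin 4 → EuclideanSpace ℝ (Fin 3)) : ℝ := twoPt Δ (x 0) (x 1) * twoPt Δ (x 2) (x 3)
/-- The three Wick products of a four-point configuration. [folklore] -/
def W2 (Δ : ℝ) (x : Fin 4 → EuclideanSpace ℝ (Fin 3)) : ℝ := twoPt Δ (x 0) (x 2) * twoPt Δ (x 1) (x 3)
/-- The three Wick products of a four-point configuration. [folklore] -/
def W3 (Δ : ℝ) (x : Fin 4 → EuclideanSpace ℝ (Fin 3)) : ℝ := twoPt Δ (x 0) (x 3) * twoPt Δ (x 1) (x 2)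

/-- `wick = W₁ + W₂ + W₃`. [folklore] -/
theorem wick_eq (Δ : ℝ) (x : Fin 4 → EuclideanSpace ℝ (Fin 3)) : wick Δ x = W1 Δ x + W2 Δ x + W3 Δ x := rfl

/-- The harmonic-type combination `harm = (W₁⁻¹ + W₂⁻¹ + W₃⁻¹)⁻¹` of the three Wick products:
a conformally COVARIANT candidate for `-U₄` (each point carries weight `2Δ` in every `W_p`). [folklore] -/
def harm (Δ : ℝ) (x : Fin 4 → EuclideanSpace ℝ (Fin 3)) : ℝ :=
  ((W1 Δ x)⁻¹ + (W2 Δ x)⁻¹ + (W3 Δ x)⁻¹)⁻¹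

/-- `W₁ > 0` on non-coincident configurations. [folklore] -/
theorem W1_pos (Δ : ℝ) {x : Fin 4 → EuclideanSpace ℝ (Fin 3)} (hx : Injective x) : 0 < W1 Δ x :=
  mul_pos (twoPt_pos Δ (hx.ne (by decide))) (twoPt_pos Δ (hx.ne (by decide)))
/-- `W₂ > 0` on non-coincident configurations. [folklore] -/
theorem W2_pos (Δ : ℝ) {x : Fin 4 → EuclideanSpace ℝ (Fin 3)} (hx : Injective x) : 0 < W2 Δ x :=
  mul_pos (twoPt_pos Δ (hx.ne (by decide))) (twoPt_pos Δ (hx.ne (by decide)))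
/-- `W₃ > 0` on non-coincident configurations. [folklore] -/
theorem W3_pos (Δ : ℝ) {x : Fin 4 → EuclideanSpace ℝ (Fin 3)} (hx : Injective x) : 0 < W3 Δ x :=
  mul_pos (twoPt_pos Δ (hx.ne (by decide))) (twoPt_pos Δ (hx.ne (by decide)))

/-- `harm > 0` on non-coincident configurations. [folklore] -/
theorem harm_pos (Δ : ℝ) {x : Fin 4 → EuclideanSpace ℝ (Fin 3)} (hx : Injective x) : 0 < harm Δ x := by
  have h1 := W1_pos Δ hx; have h2 := W2_pos Δ hx; have h3 := W3_pos Δ hx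
  unfold harm
  positivity

/-- `harm ≤ W₁` (and likewise `≤ W₂, W₃`). [folklore] -/
theorem harm_le_W1 (Δ : ℝ) {x : Fin 4 → EuclideanSpace ℝ (Fin 3)} (hx : Injective x) : harm Δ x ≤ W1 Δ x := by
  have h1 := W1_pos Δ hx; have h2 := W2_pos Δ hx; have h3 := W3_pos Δ hx
  unfold harm
  rw [inv_le_comm₀ (by positivity) h1]
  have : 0 ≤ (W2 Δ x)⁻¹ + (W3 Δ x)⁻¹ := by positivity
  linarith

/-- `harm ≤ W₂`. [folklore] -/
theorem harm_le_W2 (Δ : ℝ) {x : Fin 4 → EuclideanSpace ℝ (Fin 3)} (hx : Injective x) : harm Δ x ≤ W2 Δ x := by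
  have h1 := W1_pos Δ hx; have h2 := W2_pos Δ hx; have h3 := W3_pos Δ hx
  unfold harm
  rw [inv_le_comm₀ (by positivity) h2]
  have : 0 ≤ (W1 Δ x)⁻¹ + (W3 Δ x)⁻¹ := by positivity
  linarith

/-- `harm ≤ W₃`. [folklore] -/
theorem harm_le_W3 (Δ : ℝ) {x : Fin 4 → EuclideanSpace ℝ (Fin 3)} (hx : Injective x) : harm Δ x ≤ W3 Δ x := by
  have h1 := W1_pos Δ hx; have h2 := W2_pos Δ hx; have h3 := W3_pos Δ hx
  unfold harm
  rw [inv_le_comm₀ (by positivity) h3]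
  have : 0 ≤ (W1 Δ x)⁻¹ + (W2 Δ x)⁻¹ := by positivity
  linarith

/-- Each Wick product is inversion covariant with the full factor `∏ ‖xᵢ‖^{2Δ}`. [folklore] -/
theorem W1_inversion (Δ : ℝ) {x : Fin 4 → EuclideanSpace ℝ (Fin 3)} (hx : ∀ i, x i ≠ 0) :
    W1 Δ (fun i => inversion 0 1 (x i)) = (∏ i, ‖x i‖ ^ (2 * Δ)) * W1 Δ x := by
  simp only [W1, twoPt_inversion Δ (hx _) (hx _), Fin.prod_univ_four]; ring
/-- `W₂` is inversion covariant. [folklore] -/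
theorem W2_inversion (Δ : ℝ) {x : Fin 4 → EuclideanSpace ℝ (Fin 3)} (hx : ∀ i, x i ≠ 0) :
    W2 Δ (fun i => inversion 0 1 (x i)) = (∏ i, ‖x i‖ ^ (2 * Δ)) * W2 Δ x := by
  simp only [W2, twoPt_inversion Δ (hx _) (hx _), Fin.prod_univ_four]; ring
/-- `W₃` is inversion covariant. [folklore] -/
theorem W3_inversion (Δ : ℝ) {x : Fin 4 → EuclideanSpace ℝ (Fin 3)} (hx : ∀ i, x i ≠ 0) :
    W3 Δ (fun i => inversion 0 1 (x i)) = (∏ i, ‖x i‖ ^ (2 * Δ)) * W3 Δ x := by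
  simp only [W3, twoPt_inversion Δ (hx _) (hx _), Fin.prod_univ_four]; ring

/-- The Kelvin factor `∏ ‖xᵢ‖^{2Δ}` is positive off the origin. [folklore] -/
theorem prod_norm_rpow_pos (Δ : ℝ) {n : ℕ} {x : Fin n → EuclideanSpace ℝ (Fin 3)} (hx : ∀ i, x i ≠ 0) :
    0 < ∏ i, ‖x i‖ ^ (2 * Δ) :=
  Finset.prod_pos fun i _ => Real.rpow_pos_of_pos (norm_pos_iff.2 (hx i)) _

/-- `harm` is inversion covariant: `harm(ιx) = (∏‖xᵢ‖^{2Δ}) harm(x)`. [folklore] -/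
theorem harm_inversion (Δ : ℝ) {x : Fin 4 → EuclideanSpace ℝ (Fin 3)} (hx : ∀ i, x i ≠ 0)
    (hinj : Injective x) :
    harm Δ (fun i => inversion 0 1 (x i)) = (∏ i, ‖x i‖ ^ (2 * Δ)) * harm Δ x := by
  have hF := prod_norm_rpow_pos Δ hx
  have h1 := W1_pos Δ hinj; have h2 := W2_pos Δ hinj; have h3 := W3_pos Δ hinj
  unfold harm
  rw [W1_inversion Δ hx, W2_inversion Δ hx, W3_inversion Δ hx]
  field_simp

/-- `W_p` scale as `c^{-4Δ}`. [folklore] -/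
theorem W1_smul (Δ : ℝ) {c : ℝ} (hc : 0 < c) (x : Fin 4 → EuclideanSpace ℝ (Fin 3)) :
    W1 Δ (fun i => c • x i) = c ^ (-(2 * Δ)) * c ^ (-(2 * Δ)) * W1 Δ x := by
  simp only [W1, twoPt_smul Δ hc]; ring
/-- `W₂` scales as `c^{-4Δ}`. [folklore] -/
theorem W2_smul (Δ : ℝ) {c : ℝ} (hc : 0 < c) (x : Fin 4 → EuclideanSpace ℝ (Fin 3)) :
    W2 Δ (fun i => c • x i) = c ^ (-(2 * Δ)) * c ^ (-(2 * Δ)) * W2 Δ x := by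
  simp only [W2, twoPt_smul Δ hc]; ring
/-- `W₃` scales as `c^{-4Δ}`. [folklore] -/
theorem W3_smul (Δ : ℝ) {c : ℝ} (hc : 0 < c) (x : Fin 4 → EuclideanSpace ℝ (Fin 3)) :
    W3 Δ (fun i => c • x i) = c ^ (-(2 * Δ)) * c ^ (-(2 * Δ)) * W3 Δ x := by
  simp only [W3, twoPt_smul Δ hc]; ring

/-- `harm` scales as `c^{-4Δ}`. [folklore] -/
theorem harm_smul (Δ : ℝ) {c : ℝ} (hc : 0 < c) {x : Fin 4 → EuclideanSpace ℝ (Fin 3)} (hinj : Injective x) :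
    harm Δ (fun i => c • x i) = c ^ (-(2 * Δ)) * c ^ (-(2 * Δ)) * harm Δ x := by
  have h1 := W1_pos Δ hinj; have h2 := W2_pos Δ hinj; have h3 := W3_pos Δ hinj
  have hc' : 0 < c ^ (-(2 * Δ)) := Real.rpow_pos_of_pos hc _
  unfold harm
  rw [W1_smul Δ hc, W2_smul Δ hc, W3_smul Δ hc]
  field_simp

/-- `harm` is translation invariant. [folklore] -/
theorem harm_add (Δ : ℝ) (v : EuclideanSpace ℝ (Fin 3)) (x : Fin 4 → EuclideanSpace ℝ (Fin 3)) :
    harm Δ (fun i => x i + v) = harm Δ x := by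
  simp only [harm, W1, W2, W3, twoPt_add]

/-- `harm` is `O(3)` invariant. [folklore] -/
theorem harm_map (Δ : ℝ) (R : EuclideanSpace ℝ (Fin 3) ≃ₗᵢ[ℝ] EuclideanSpace ℝ (Fin 3))
    (x : Fin 4 → EuclideanSpace ℝ (Fin 3)) : harm Δ (fun i => R (x i)) = harm Δ x := by
  simp only [harm, W1, W2, W3, twoPt_map]

/-! ## Six points: Wick sum and bump -/

/-- The Gaussian six-point function: sum over the 15 pairings. [folklore] -/
def wick6 (Δ : ℝ) (x : Fin 6 → EuclideanSpace ℝ (Fin 3)) : ℝ :=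
  twoPt Δ (x 0) (x 1) * twoPt Δ (x 2) (x 3) * twoPt Δ (x 4) (x 5) +
  twoPt Δ (x 0) (x 1) * twoPt Δ (x 2) (x 4) * twoPt Δ (x 3) (x 5) +
  twoPt Δ (x 0) (x 1) * twoPt Δ (x 2) (x 5) * twoPt Δ (x 3) (x 4) +
  twoPt Δ (x 0) (x 2) * twoPt Δ (x 1) (x 3) * twoPt Δ (x 4) (x 5) +
  twoPt Δ (x 0) (x 2) * twoPt Δ (x 1) (x 4) * twoPt Δ (x 3) (x 5) +
  twoPt Δ (x 0) (x 2) * twoPt Δ (x 1) (x 5) * twoPt Δ (x 3) (x 4) +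
  twoPt Δ (x 0) (x 3) * twoPt Δ (x 1) (x 2) * twoPt Δ (x 4) (x 5) +
  twoPt Δ (x 0) (x 3) * twoPt Δ (x 1) (x 4) * twoPt Δ (x 2) (x 5) +
  twoPt Δ (x 0) (x 3) * twoPt Δ (x 1) (x 5) * twoPt Δ (x 2) (x 4) +
  twoPt Δ (x 0) (x 4) * twoPt Δ (x 1) (x 2) * twoPt Δ (x 3) (x 5) +
  twoPt Δ (x 0) (x 4) * twoPt Δ (x 1) (x 3) * twoPt Δ (x 2) (x 5) +
  twoPt Δ (x 0) (x 4) * twoPt Δ (x 1) (x 5) * twoPt Δ (x 2) (x 3) +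
  twoPt Δ (x 0) (x 5) * twoPt Δ (x 1) (x 2) * twoPt Δ (x 3) (x 4) +
  twoPt Δ (x 0) (x 5) * twoPt Δ (x 1) (x 3) * twoPt Δ (x 2) (x 4) +
  twoPt Δ (x 0) (x 5) * twoPt Δ (x 1) (x 4) * twoPt Δ (x 2) (x 3)

/-- `∑ᵢ ∑ⱼ ‖xᵢ - xⱼ‖²` over ordered pairs of a six-point configuration. [folklore] -/
def sqSum6 (x : Fin 6 → EuclideanSpace ℝ (Fin 3)) : ℝ := ∑ i, ∑ j, ‖x i - x j‖ ^ 2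

/-- The non-covariant six-point connected perturbation `(∑ᵢⱼ‖xᵢ−xⱼ‖²)^{-3Δ}`. [folklore] -/
def bump6 (Δ : ℝ) (x : Fin 6 → EuclideanSpace ℝ (Fin 3)) : ℝ := sqSum6 x ^ (-(3 * Δ))

/-- The six-point Wick sum IS inversion covariant (each pairing term is). [folklore] -/
theorem wick6_inversion (Δ : ℝ) {x : Fin 6 → EuclideanSpace ℝ (Fin 3)} (hx : ∀ i, x i ≠ 0) :
    wick6 Δ (fun i => inversion 0 1 (x i)) = (∏ i, ‖x i‖ ^ (2 * Δ)) * wick6 Δ x := by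
  simp only [wick6, twoPt_inversion Δ (hx _) (hx _), Fin.prod_univ_six]; ring

/-- The six-point Wick sum scales as `c^{-6Δ}`. [folklore] -/
theorem wick6_smul (Δ : ℝ) {c : ℝ} (hc : 0 < c) (x : Fin 6 → EuclideanSpace ℝ (Fin 3)) :
    wick6 Δ (fun i => c • x i) = c ^ (-(2 * Δ)) * c ^ (-(2 * Δ)) * c ^ (-(2 * Δ)) * wick6 Δ x := by
  simp only [wick6, twoPt_smul Δ hc]; ring

/-- The six-point Wick sum is translation invariant. [folklore] -/
theorem wick6_add (Δ : ℝ) (v : EuclideanSpace ℝ (Fin 3)) (x : Fin 6 → EuclideanSpace ℝ (Fin 3)) :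
    wick6 Δ (fun i => x i + v) = wick6 Δ x := by
  simp only [wick6, twoPt_add]

/-- The six-point Wick sum is `O(3)` invariant. [folklore] -/
theorem wick6_map (Δ : ℝ) (R : EuclideanSpace ℝ (Fin 3) ≃ₗᵢ[ℝ] EuclideanSpace ℝ (Fin 3))
    (x : Fin 6 → EuclideanSpace ℝ (Fin 3)) : wick6 Δ (fun i => R (x i)) = wick6 Δ x := by
  simp only [wick6, twoPt_map]

/-- `sqSum6 ≥ 0`. [folklore] -/
theorem sqSum6_nonneg (x : Fin 6 → EuclideanSpace ℝ (Fin 3)) : 0 ≤ sqSum6 x :=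
  Finset.sum_nonneg fun _ _ => Finset.sum_nonneg fun _ _ => sq_nonneg _

/-- `sqSum6` is translation invariant. [folklore] -/
theorem sqSum6_add (v : EuclideanSpace ℝ (Fin 3)) (x : Fin 6 → EuclideanSpace ℝ (Fin 3)) :
    sqSum6 (fun i => x i + v) = sqSum6 x := by simp [sqSum6]

/-- `sqSum6` is `O(3)` invariant. [folklore] -/
theorem sqSum6_map (R : EuclideanSpace ℝ (Fin 3) ≃ₗᵢ[ℝ] EuclideanSpace ℝ (Fin 3))
    (x : Fin 6 → EuclideanSpace ℝ (Fin 3)) : sqSum6 (fun i => R (x i)) = sqSum6 x := by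
  simp [sqSum6, ← map_sub]

/-- `sqSum6` is homogeneous of degree `2`. [folklore] -/
theorem sqSum6_smul {c : ℝ} (hc : 0 < c) (x : Fin 6 → EuclideanSpace ℝ (Fin 3)) :
    sqSum6 (fun i => c • x i) = c ^ 2 * sqSum6 x := by
  simp only [sqSum6, ← smul_sub, norm_smul, Real.norm_eq_abs, abs_of_pos hc, mul_pow, Finset.mul_sum]

/-- `bump6` scales as `c^{-6Δ}`. [folklore] -/
theorem bump6_smul (Δ : ℝ) {c : ℝ} (hc : 0 < c) (x : Fin 6 → EuclideanSpace ℝ (Fin 3)) :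
    bump6 Δ (fun i => c • x i) = c ^ (-(2 * Δ)) * c ^ (-(2 * Δ)) * c ^ (-(2 * Δ)) * bump6 Δ x := by
  rw [bump6, bump6, sqSum6_smul hc, Real.mul_rpow (by positivity) (sqSum6_nonneg x),
    ← Real.rpow_natCast c 2, ← Real.rpow_mul hc.le]
  rw [← Real.rpow_add hc, ← Real.rpow_add hc]
  push_cast
  ring_nf

/-! ## The witness family -/

open Classical in
/-- The six-point witness: `S₀ = 1`, `S₂ = twoPt`, `S₄ = wick − harm` (CONFORMALLY COVARIANT,
`U₄ = -harm < 0`), `S₆ = wick6 − bump6` (NOT covariant), `0` otherwise and on coincident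
configurations. [folklore] -/
def sixFamily (Δ : ℝ) : CorrFamily 3 := fun n =>
  match n with
  | 0 => fun _ => 1
  | 2 => fun x => twoPt Δ (x 0) (x 1)
  | 4 => fun x => if Function.Injective x then wick Δ x - harm Δ x else 0
  | 6 => fun x => if Function.Injective x then wick6 Δ x - bump6 Δ x else 0
  | _ => fun _ => 0

/-- Unfolding, `n = 2`. [folklore] -/
theorem sixFamily_two (Δ : ℝ) (x : Fin 2 → EuclideanSpace ℝ (Fin 3)) :
    sixFamily Δ 2 x = twoPt Δ (x 0) (x 1) := rfl

open Classical in
/-- Unfolding, `n = 4`. [folklore] -/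
theorem sixFamily_four (Δ : ℝ) (x : Fin 4 → EuclideanSpace ℝ (Fin 3)) :
    sixFamily Δ 4 x = if Function.Injective x then wick Δ x - harm Δ x else 0 := rfl

open Classical in
/-- Unfolding, `n = 6`. [folklore] -/
theorem sixFamily_six (Δ : ℝ) (x : Fin 6 → EuclideanSpace ℝ (Fin 3)) :
    sixFamily Δ 6 x = if Function.Injective x then wick6 Δ x - bump6 Δ x else 0 := rfl

/-- Normalisation off `NonCoincident` (`Δ ≠ 0`). [folklore] -/
theorem sixFamily_eq_zero_of_not_mem {Δ : ℝ} (hΔ : Δ ≠ 0) (n : ℕ)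
    (x : Fin n → EuclideanSpace ℝ (Fin 3)) (hx : x ∉ NonCoincident 3 n) : sixFamily Δ n x = 0 := by
  rw [mem_nonCoincident] at hx
  match n, x, hx with
  | 0, x, hx => exact absurd (Function.injective_of_subsingleton x) hx
  | 1, _, _ => rfl
  | 2, x, hx =>
    rw [sixFamily_two]
    have h01 : x 0 = x 1 := by
      by_contra h
      exact hx ((injective_fin_two_iff x).2 h)
    rw [h01]
    exact twoPt_self hΔ _
  | 3, _, _ => rfl
  | 4, x, hx => rw [sixFamily_four, if_neg hx]
  | 5, _, _ => rfl
  | 6, x, hx => rw [sixFamily_six, if_neg hx]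
  | (n + 7), _, _ => rfl

/-- Non-degenerate two-point function. [folklore] -/
theorem sixFamily_isNondegenerateTwoPoint (Δ : ℝ) : IsNondegenerateTwoPoint (sixFamily Δ) := by
  intro x hx
  rw [sixFamily_two]
  exact twoPt_pos Δ ((mem_nonCoincident x |>.1 hx).ne (by decide))

/-- Translation invariance. [folklore] -/
theorem sixFamily_isTranslationInvariant (Δ : ℝ) : IsTranslationInvariant (sixFamily Δ) := by
  intro n v x
  match n, x with
  | 0, _ => rfl
  | 1, _ => rfl
  | 2, x => simp [sixFamily_two, twoPt_add]
  | 3, _ => rfl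
  | 4, x =>
    simp only [sixFamily_four, injective_comp_iff (add_left_injective v) x, wick, twoPt_add, harm_add]
  | 5, _ => rfl
  | 6, x =>
    simp only [sixFamily_six, injective_comp_iff (add_left_injective v) x, wick6_add, bump6, sqSum6_add]
  | (n + 7), _ => rfl

/-- `O(3)` invariance. [folklore] -/
theorem sixFamily_isRotationInvariant (Δ : ℝ) : IsRotationInvariant (sixFamily Δ) := by
  intro n R x
  match n, x with
  | 0, _ => rfl
  | 1, _ => rfl
  | 2, x => simp [sixFamily_two, twoPt_map]
  | 3, _ => rfl
  | 4, x =>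
    simp only [sixFamily_four, injective_comp_iff R.injective x, wick, twoPt_map, harm_map]
  | 5, _ => rfl
  | 6, x =>
    simp only [sixFamily_six, injective_comp_iff R.injective x, wick6_map, bump6, sqSum6_map]
  | (n + 7), _ => rfl

/-- Euclidean invariance. [folklore] -/
theorem sixFamily_isEuclideanInvariant (Δ : ℝ) : IsEuclideanInvariant (sixFamily Δ) :=
  ⟨sixFamily_isTranslationInvariant Δ, sixFamily_isRotationInvariant Δ⟩

/-- Scale covariance with dimension `Δ`. [folklore] -/
theorem sixFamily_isScaleCovariant (Δ : ℝ) : IsScaleCovariant Δ (sixFamily Δ) := by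
  intro n c hc x
  match n, x with
  | 0, _ => simp [sixFamily]
  | 1, _ => simp [sixFamily]
  | 2, x =>
    have h1 : (-((2 : ℕ) : ℝ) * Δ) = -(2 * Δ) := by push_cast; ring
    rw [sixFamily_two, sixFamily_two, h1]
    exact twoPt_smul Δ hc _ _
  | 3, _ => simp [sixFamily]
  | 4, x =>
    have hinj := injective_comp_iff (smul_right_injective _ hc.ne') x
    by_cases hx : Function.Injective x
    · rw [sixFamily_four, sixFamily_four, if_pos (hinj.2 hx), if_pos hx, wick_smul Δ hc, harm_smul Δ hc hx]
      have h1 : (-((4 : ℕ) : ℝ) * Δ) = -(2 * Δ) + -(2 * Δ) := by push_cast; ring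
      rw [h1, Real.rpow_add hc]
      ring
    · rw [sixFamily_four, sixFamily_four, if_neg (mt hinj.1 hx), if_neg hx, mul_zero]
  | 5, _ => simp [sixFamily]
  | 6, x =>
    have hinj := injective_comp_iff (smul_right_injective _ hc.ne') x
    by_cases hx : Function.Injective x
    · rw [sixFamily_six, sixFamily_six, if_pos (hinj.2 hx), if_pos hx, wick6_smul Δ hc, bump6_smul Δ hc]
      have h1 : (-((6 : ℕ) : ℝ) * Δ) = -(2 * Δ) + -(2 * Δ) + -(2 * Δ) := by push_cast; ring
      rw [h1, Real.rpow_add hc, Real.rpow_add hc]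
      ring
    · rw [sixFamily_six, sixFamily_six, if_neg (mt hinj.1 hx), if_neg hx, mul_zero]
  | (n + 7), _ => simp [sixFamily]

/-- `U₄ = -harm` on non-coincident configurations. [folklore] -/
theorem limitConnectedFour_sixFamily (Δ : ℝ) {x : Fin 4 → EuclideanSpace ℝ (Fin 3)}
    (hx : Function.Injective x) : limitConnectedFour (sixFamily Δ) x = -harm Δ x := by
  simp only [limitConnectedFour, sixFamily_four, if_pos hx, sixFamily_two, wick, harm, W1, W2, W3,
    Matrix.cons_val_zero, Matrix.cons_val_one]
  ring

/-- `U₄ = -wick` on coincident configurations (normalisation). [folklore] -/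
theorem limitConnectedFour_sixFamily_of_not_injective (Δ : ℝ)
    {x : Fin 4 → EuclideanSpace ℝ (Fin 3)} (hx : ¬ Function.Injective x) :
    limitConnectedFour (sixFamily Δ) x = -wick Δ x := by
  simp only [limitConnectedFour, sixFamily_four, if_neg hx, sixFamily_two, wick,
    Matrix.cons_val_zero, Matrix.cons_val_one]
  ring

/-- Lebowitz shape: `U₄ ≤ 0` everywhere. [folklore] -/
theorem limitConnectedFour_sixFamily_nonpos (Δ : ℝ) (x : Fin 4 → EuclideanSpace ℝ (Fin 3)) :
    limitConnectedFour (sixFamily Δ) x ≤ 0 := by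
  by_cases hx : Function.Injective x
  · rw [limitConnectedFour_sixFamily Δ hx, neg_nonpos]; exact (harm_pos Δ hx).le
  · rw [limitConnectedFour_sixFamily_of_not_injective Δ hx, neg_nonpos]; exact wick_nonneg Δ x

/-- `U₄ ≢ 0` (indeed `U₄ < 0` on non-coincident configurations): the witness is NOT Gaussian at four points. [folklore] -/
theorem sixFamily_hasNontrivialU4 (Δ : ℝ) : HasNontrivialU4 (sixFamily Δ) :=
  ⟨configInv, configInv_injective, by
    rw [limitConnectedFour_sixFamily Δ configInv_injective, neg_ne_zero]
    exact (harm_pos Δ configInv_injective).ne'⟩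

/-- Griffiths-I shape at four points and positivity of `S₄`: `S₄ ≥ W₁ + W₂ ≥ 0`. [folklore] -/
theorem sixFamily_four_nonneg (Δ : ℝ) (x : Fin 4 → EuclideanSpace ℝ (Fin 3)) : 0 ≤ sixFamily Δ 4 x := by
  by_cases hx : Function.Injective x
  · rw [sixFamily_four, if_pos hx, wick_eq]
    have h1 := (W1_pos Δ hx).le; have h2 := (W2_pos Δ hx).le
    have h3 := harm_le_W3 Δ hx
    linarith
  · rw [sixFamily_four, if_neg hx]

/-! ## Inversion: covariant at every order except six -/

/-- **Inversion covariance holds at EVERY order `n ≠ 6`** (in particular at `n = 4`, with the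
non-Gaussian covariant connected part `-harm`). [folklore] -/
theorem sixFamily_invIdentity_of_ne_six (Δ : ℝ) {n : ℕ} (hn : n ≠ 6)
    (x : Fin n → EuclideanSpace ℝ (Fin 3)) (hx : ∀ i, x i ≠ 0) :
    sixFamily Δ n (fun i => inversion 0 1 (x i)) = (∏ i, ‖x i‖ ^ (2 * Δ)) * sixFamily Δ n x := by
  match n, x, hx, hn with
  | 0, x, _, _ =>
    have h : (fun i => inversion 0 1 (x i)) = x := funext fun i => i.elim0
    rw [h]
    simp [sixFamily]
  | 1, _, _, _ => simp [sixFamily]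
  | 2, x, hx, _ =>
    rw [sixFamily_two, sixFamily_two, Fin.prod_univ_two]
    exact twoPt_inversion Δ (hx 0) (hx 1)
  | 3, _, _, _ => simp [sixFamily]
  | 4, x, hx, _ =>
    have hinj := injective_comp_iff (inversion_injective (0 : EuclideanSpace ℝ (Fin 3)) one_ne_zero) x
    by_cases h : Function.Injective x
    · rw [sixFamily_four, sixFamily_four, if_pos (hinj.2 h), if_pos h, wick_inversion Δ hx,
        harm_inversion Δ hx h, mul_sub]
    · rw [sixFamily_four, sixFamily_four, if_neg (mt hinj.1 h), if_neg h, mul_zero]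
  | 5, _, _, _ => simp [sixFamily]
  | 6, _, _, hn => exact absurd rfl hn
  | (n + 7), _, _, _ => simp [sixFamily]

/-- The six-point axis configuration `(e, 2e, …, 6e)`. [folklore] -/
def config6 : Fin 6 → EuclideanSpace ℝ (Fin 3) := fun i => axisPt (((i : ℕ) : ℝ) + 1)

/-- `(e, 2e, …, 6e)` is non-coincident. [folklore] -/
theorem config6_injective : Function.Injective config6 := by
  intro i j hij
  have h := axisPt_injective hij
  exact Fin.ext (Nat.cast_injective (R := ℝ) (by linarith))

/-- `(e, 2e, …, 6e)` avoids the origin. [folklore] -/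
theorem config6_ne_zero (i : Fin 6) : config6 i ≠ 0 :=
  axisPt_ne_zero (by positivity)

/-- The inverted configuration is `(e, e/2, …, e/6)`. [folklore] -/
theorem inversion_config6 (i : Fin 6) : inversion 0 1 (config6 i) = axisPt ((((i : ℕ) : ℝ) + 1)⁻¹) :=
  inversion_axisPt (by positivity)

/-- `sqSum6 (e, 2e, …, 6e) = 210`. [folklore] -/
theorem sqSum6_config6 : sqSum6 config6 = 210 := by
  simp only [sqSum6, Fin.sum_univ_six, config6, norm_axisPt_sub_axisPt]
  simp
  norm_num

/-- `sqSum6 (e, e/2, …, e/6) = 707/120`. [folklore] -/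
theorem sqSum6_inversion_config6 : sqSum6 (fun i => inversion 0 1 (config6 i)) = 707 / 120 := by
  simp only [sqSum6, Fin.sum_univ_six, inversion_config6, norm_axisPt_sub_axisPt]
  simp
  norm_num

/-- `∏ ‖k e‖^{2Δ} = 720^{2Δ}` for `k = 1, …, 6`. [folklore] -/
theorem prod_norm_config6 (Δ : ℝ) : (∏ i, ‖config6 i‖ ^ (2 * Δ)) = (720 : ℝ) ^ (2 * Δ) := by
  rw [Real.finsetProd_rpow _ _ (fun i _ => norm_nonneg _)]
  congr 1
  simp only [Fin.prod_univ_six, config6, norm_axisPt]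
  simp
  norm_num [abs_of_pos]

/-- **The six-point identity FAILS** for every `Δ > 0`: at `(e, 2e, …, 6e)` the Wick parts match but
the bumps would need `(707/120)^{-3Δ} = 720^{2Δ}·210^{-3Δ}`, i.e. `((120/707)³)^Δ = (720²/210³)^Δ`,
and `(120/707)³ ≈ 0.0049 < 0.056 ≈ 720²/210³`. [folklore] -/
theorem sixFamily_not_invIdentity_six {Δ : ℝ} (hΔ : 0 < Δ) :
    ¬ ∀ x : Fin 6 → EuclideanSpace ℝ (Fin 3), (∀ i, x i ≠ 0) →
      sixFamily Δ 6 (fun i => inversion 0 1 (x i)) = (∏ i, ‖x i‖ ^ (2 * Δ)) * sixFamily Δ 6 x := by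
  intro h
  have key := h config6 config6_ne_zero
  have hinj' : Function.Injective (fun i => inversion 0 1 (config6 i)) :=
    (inversion_injective (0 : EuclideanSpace ℝ (Fin 3)) one_ne_zero).comp config6_injective
  rw [sixFamily_six, sixFamily_six, if_pos hinj', if_pos config6_injective,
    wick6_inversion Δ config6_ne_zero, mul_sub] at key
  have key2 : bump6 Δ (fun i => inversion 0 1 (config6 i)) =
      (∏ i, ‖config6 i‖ ^ (2 * Δ)) * bump6 Δ config6 := by linarith
  rw [bump6, bump6, sqSum6_inversion_config6, sqSum6_config6, prod_norm_config6] at key2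
  -- key2 : (707/120)^(-(3Δ)) = 720^(2Δ) * 210^(-(3Δ))
  have e1 : (707 / 120 : ℝ) ^ (-(3 * Δ)) = ((120 / 707 : ℝ) ^ (3:ℝ)) ^ Δ := by
    rw [Real.rpow_neg (by norm_num), ← Real.inv_rpow (by norm_num), inv_div,
      ← Real.rpow_mul (by norm_num)]
  have e2 : (720 : ℝ) ^ (2 * Δ) * (210 : ℝ) ^ (-(3 * Δ)) = ((720 : ℝ) ^ (2:ℝ) / (210 : ℝ) ^ (3:ℝ)) ^ Δ := by
    rw [Real.div_rpow (by positivity) (by positivity), ← Real.rpow_mul (by norm_num),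
      ← Real.rpow_mul (by norm_num), Real.rpow_neg (by norm_num), div_eq_mul_inv]
  have hlt : ((120 / 707 : ℝ) ^ (3:ℝ)) < (720 : ℝ) ^ (2:ℝ) / (210 : ℝ) ^ (3:ℝ) := by
    rw [show (3:ℝ) = ((3:ℕ):ℝ) by norm_num, show (2:ℝ) = ((2:ℕ):ℝ) by norm_num,
      Real.rpow_natCast, Real.rpow_natCast, Real.rpow_natCast]
    norm_num
  have lt : ((120 / 707 : ℝ) ^ (3:ℝ)) ^ Δ < ((720 : ℝ) ^ (2:ℝ) / (210 : ℝ) ^ (3:ℝ)) ^ Δ :=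
    Real.rpow_lt_rpow (by positivity) hlt hΔ
  rw [e1, e2] at key2
  exact lt.ne key2

/-- Hence the witness is not inversion covariant (only the order-`6` clause fails). [folklore] -/
theorem sixFamily_not_isInversionCovariant {Δ : ℝ} (hΔ : 0 < Δ) : ¬ IsInversionCovariant Δ (sixFamily Δ) :=
  fun h => sixFamily_not_invIdentity_six hΔ (h 6)


end SixPt

/-- **(SixPt) four-point covariance does not propagate** (model-blind, every `Δ > 0`): a
normalised, non-degenerate, Euclidean-invariant, scale-covariant family with `U₄ ≢ 0`, `U₄ ≤ 0`,
satisfying the inversion identity at every order `n ≠ 6` and violating it at order `6`. So a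
four-point stub (`FourPointOneSided`, `CriticalRobinLaw`, `RatioInversionInvariance`) closes the
crux only with an all-orders mechanism; the tree has one on the Gaussian locus only (Wick
dichotomy, `HasPointwiseScalingLimit.eq_pairingSum_of_limitConnectedFour_eq_zero`). [folklore] -/
theorem fourPointDoesNotPropagate {Δ : ℝ} (hΔ : 0 < Δ) :
    ∃ S : CorrFamily 3, (∀ n z, z ∉ NonCoincident 3 n → S n z = 0) ∧ IsNondegenerateTwoPoint S ∧
      IsEuclideanInvariant S ∧ IsScaleCovariant Δ S ∧ HasNontrivialU4 S ∧
      (∀ x, limitConnectedFour S x ≤ 0) ∧ (∀ n, n ≠ 6 → InvIdentityAt Δ S n) ∧ ¬ InvIdentityAt Δ S 6 :=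
  ⟨SixPt.sixFamily Δ, SixPt.sixFamily_eq_zero_of_not_mem hΔ.ne', SixPt.sixFamily_isNondegenerateTwoPoint Δ,
    SixPt.sixFamily_isEuclideanInvariant Δ, SixPt.sixFamily_isScaleCovariant Δ, SixPt.sixFamily_hasNontrivialU4 Δ,
    SixPt.limitConnectedFour_sixFamily_nonpos Δ, fun _ hn x hx => SixPt.sixFamily_invIdentity_of_ne_six Δ hn x hx,
    SixPt.sixFamily_not_invIdentity_six hΔ⟩

/-! ## §7'' Reflection positivity forces every even order to be non-zero (PROVED; tree `Negative/ReflectionPositiveOrders.lean`)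

Constraint on RP decoys, general `d`, any axis `τ`. -/

section RPOrders

variable {d : ℕ} {τ : Fin d}

/-- **OS Cauchy–Schwarz.** Under reflection positivity (with a symmetric OS kernel), a vanishing
diagonal entry `K(a,a) = 0` kills the whole row: `K(a,b) = 0` for every `b`. [cite: GlimmJaffe1987, §6.1 Prop. 6.1.1] -/
theorem osPointKernel_eq_zero_of_self_eq_zero {S : CorrFamily d} (hRP : IsReflectionPositiveAlong τ S)
    (hR : IsReflectionInvariantAlong τ S) (hP : IsPermutationSymmetric S)
    {a : HalfSpaceConfig d τ} (ha : osPointKernel S a a = 0) (b : HalfSpaceConfig d τ) :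
    osPointKernel S a b = 0 := by
  by_contra hs
  set s := osPointKernel S a b with hs_def
  set t := osPointKernel S b b with ht_def
  have hba : osPointKernel S b a = s := (osPointKernel_comm hR hP b a).trans rfl
  have key := hRP 2 ![a, b] ![-(t + 1) / (2 * s), 1]
  simp only [Fin.sum_univ_two, Matrix.cons_val_zero, Matrix.cons_val_one] at key
  rw [ha, hba, ← hs_def, ← ht_def] at key
  have h1 : -(t + 1) / (2 * s) * 1 * s = -(t + 1) / 2 := by field_simp
  have h2 : 1 * (-(t + 1) / (2 * s)) * s = -(t + 1) / 2 := by field_simp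
  rw [mul_zero, h1, h2] at key
  linarith

/-- Permutation symmetry: `S` depends only on the SET of (distinct) points. [folklore] -/
theorem corr_eq_of_range_eq {S : CorrFamily d} (hP : IsPermutationSymmetric S) {n n' : ℕ}
    {x : Fin n → EuclideanSpace ℝ (Fin d)} {x' : Fin n' → EuclideanSpace ℝ (Fin d)}
    (hx : Injective x) (hx' : Injective x') (h : Set.range x = Set.range x') : S n x = S n' x' := by
  let e : Fin n' ≃ Fin n :=
    (Equiv.ofInjective x' hx').trans ((Equiv.setCongr h.symm).trans (Equiv.ofInjective x hx).symm)
  have he : ∀ j, x (e j) = x' j := by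
    intro j
    show x ((Equiv.ofInjective x hx).symm ((Equiv.setCongr h.symm) (Equiv.ofInjective x' hx' j))) = x' j
    rw [Equiv.apply_ofInjective_symm hx]
    rfl
  calc S n x = S n' (x ∘ e) := (hP.comp_equiv e x).symm
    _ = S n' x' := by
        congr 1
        funext j
        exact he j

/-- `θ_τ (p + t e_τ) = θ_τ p - t e_τ`. [folklore] -/
theorem axisReflection_add_single (p : EuclideanSpace ℝ (Fin d)) (t : ℝ) :
    axisReflection τ (p + EuclideanSpace.single τ t) = axisReflection τ p - EuclideanSpace.single τ t := by
  ext i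
  simp only [axisReflection_apply, PiLp.add_apply, PiLp.sub_apply, PiLp.single_apply]
  split_ifs with h
  · simp [h]; ring
  · simp

/-- `θ_τ (θ_τ p + t e_τ) = p - t e_τ`. [folklore] -/
theorem axisReflection_axisReflection_add_single (p : EuclideanSpace ℝ (Fin d)) (t : ℝ) :
    axisReflection τ (axisReflection τ p + EuclideanSpace.single τ t) = p - EuclideanSpace.single τ t := by
  rw [axisReflection_add_single, axisReflection_axisReflection]

/-- **DOWNWARD STEP.** If the OS rows of all `(k+1)`-point half-space configurations with pairwise
distinct heights vanish, then the OS diagonal entries of all `k`-point configurations with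
distinct heights vanish (`k ≥ 1`): translate `θa' ⊔ a'` down along `e_τ` until exactly the lowest
point of `a'` has crossed the mirror; the result is `θP ⊔ Q` with `|P| = k+1`, `|Q| = k-1`.
[folklore] -/
theorem osPointKernel_self_eq_zero_down {S : CorrFamily d} (hP : IsPermutationSymmetric S)
    (hT : IsTranslationInvariant S) {k : ℕ}
    (hrow : ∀ a : HalfSpaceConfig d τ, a.n = k + 1 → Injective (fun i => a.pts i τ) →
      ∀ b : HalfSpaceConfig d τ, osPointKernel S a b = 0)
    (a' : HalfSpaceConfig d τ) (hk : a'.n = k) (hk1 : 1 ≤ k) (hinj : Injective (fun i => a'.pts i τ)) :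
    osPointKernel S a' a' = 0 := by
  obtain ⟨n, p, hpinj, hpos⟩ := a'
  simp only at hk hinj
  subst hk
  obtain ⟨m, rfl⟩ : ∃ m, n = m + 1 := ⟨n - 1, by omega⟩
  -- the lowest point `i₀` and a level `T` strictly between it and the others
  obtain ⟨i₀, -, hi₀⟩ := Finset.exists_min_image Finset.univ (fun i => p i τ) Finset.univ_nonempty
  have hlt : ∀ j, j ≠ i₀ → p i₀ τ < p j τ := fun j hj =>
    lt_of_le_of_ne (hi₀ j (Finset.mem_univ j)) fun h => hj (hinj h).symm
  obtain ⟨T, hT1, hT2⟩ : ∃ T, p i₀ τ < T ∧ ∀ j, j ≠ i₀ → T ≤ p j τ := by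
    by_cases hne : (Finset.univ.erase i₀).Nonempty
    · refine ⟨(Finset.univ.erase i₀).inf' hne (fun i => p i τ), ?_, fun j hj => ?_⟩
      · obtain ⟨j, hj, hjeq⟩ := Finset.exists_mem_eq_inf' hne (fun i => p i τ)
        rw [hjeq]
        exact hlt j (Finset.ne_of_mem_erase hj)
      · exact Finset.inf'_le _ (Finset.mem_erase.2 ⟨hj, Finset.mem_univ j⟩)
    · refine ⟨p i₀ τ + 1, by linarith, fun j hj => ?_⟩
      exact absurd ⟨j, Finset.mem_erase.2 ⟨hj, Finset.mem_univ j⟩⟩ hne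
  set t : ℝ := (p i₀ τ + T) / 2 with ht_def
  have ht1 : p i₀ τ < t := by rw [ht_def]; linarith
  have ht2 : ∀ j, j ≠ i₀ → t < p j τ := fun j hj => by
    have := hT2 j hj; rw [ht_def]; linarith
  set v : EuclideanSpace ℝ (Fin d) := EuclideanSpace.single τ t with hv_def
  have hvτ : v τ = t := by simp [hv_def]
  -- the new configurations
  let P : HalfSpaceConfig d τ :=
    { n := (m + 1) + 1
      pts := Fin.append (fun i => p i + v) (fun _ : Fin 1 => axisReflection τ (p i₀) + v)
      injective := by
        rw [Fin.append_injective_iff]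
        refine ⟨(add_left_injective v).comp hpinj, Function.injective_of_subsingleton _, fun i j h => ?_⟩
        have h1 := congrArg (fun z : EuclideanSpace ℝ (Fin d) => z τ) h
        simp only [PiLp.add_apply, axisReflection_apply, if_true] at h1
        linarith [hpos i, hpos i₀]
      pos := by
        intro i
        refine Fin.addCases (fun j => ?_) (fun j => ?_) i
        · simp only [Fin.append_left, PiLp.add_apply, hvτ]
          linarith [hpos j, hpos i₀, ht1]
        · simp only [Fin.append_right, PiLp.add_apply, axisReflection_apply, if_true, hvτ]
          linarith }
  let Q : HalfSpaceConfig d τ :=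
    { n := m
      pts := fun j => p (i₀.succAbove j) - v
      injective := fun j j' h => Fin.succAbove_right_injective (hpinj (sub_left_injective h))
      pos := fun j => by
        simp only [PiLp.sub_apply, hvτ]
        linarith [ht2 _ (Fin.succAbove_ne i₀ j)] }
  have hPinj : Injective (fun i => P.pts i τ) := by
    intro i j h
    revert h
    refine Fin.addCases (fun i' => ?_) (fun i' => ?_) i <;>
      refine Fin.addCases (fun j' => ?_) (fun j' => ?_) j <;> intro h
    · simp only [P, Fin.append_left, PiLp.add_apply, hvτ, add_left_inj] at h
      rw [hinj h]
    · simp only [P, Fin.append_left, Fin.append_right, PiLp.add_apply, axisReflection_apply, if_true,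
        hvτ] at h
      linarith [hpos i', hpos i₀]
    · simp only [P, Fin.append_left, Fin.append_right, PiLp.add_apply, axisReflection_apply, if_true,
        hvτ] at h
      linarith [hpos j', hpos i₀]
    · rw [Subsingleton.elim i' j']
  have hzero := hrow P rfl hPinj Q
  -- compare `K(a', a')` with `K(P, Q)`: same set of points after translating by `-v`
  have hx : Injective (Fin.append (fun i => axisReflection τ (p i)) p) :=
    osPointKernel_arg_injective ⟨m + 1, p, hpinj, hpos⟩ ⟨m + 1, p, hpinj, hpos⟩
  have hy : Injective (fun i => Fin.append (fun i => axisReflection τ (p i)) p i + (-v)) :=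
    (add_left_injective (-v)).comp hx
  have hz : Injective (Fin.append (fun i => axisReflection τ (P.pts i)) Q.pts) :=
    osPointKernel_arg_injective P Q
  have hθv : ∀ q : EuclideanSpace ℝ (Fin d), axisReflection τ (q + v) = axisReflection τ q - v :=
    fun q => by rw [hv_def]; exact axisReflection_add_single q t
  have hθθv : ∀ q : EuclideanSpace ℝ (Fin d), axisReflection τ (axisReflection τ q + v) = q - v :=
    fun q => by rw [hv_def]; exact axisReflection_axisReflection_add_single q t
  have hrange : Set.range (fun i => Fin.append (fun i => axisReflection τ (p i)) p i + (-v)) =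
      Set.range (Fin.append (fun i => axisReflection τ (P.pts i)) Q.pts) := by
    -- membership in the range of an `append`
    have mem_append : ∀ {α : Type} {a b : ℕ} (f : Fin a → α) (g : Fin b → α) (y : α),
        y ∈ Set.range (Fin.append f g) ↔ (∃ i, f i = y) ∨ ∃ j, g j = y := by
      intro α a b f g y
      constructor
      · rintro ⟨i, rfl⟩
        refine Fin.addCases (fun j => ?_) (fun j => ?_) i
        · exact Or.inl ⟨j, (Fin.append_left f g j).symm⟩
        · exact Or.inr ⟨j, (Fin.append_right f g j).symm⟩
      · rintro (⟨j, rfl⟩ | ⟨j, rfl⟩)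
        · exact ⟨Fin.castAdd b j, Fin.append_left f g j⟩
        · exact ⟨Fin.natAdd a j, Fin.append_right f g j⟩
    ext y
    rw [Set.mem_range, mem_append]
    constructor
    · rintro ⟨i, rfl⟩
      refine Fin.addCases (fun j => ?_) (fun j => ?_) i
      · -- reflected point of `a'`, shifted: comes from the first block of `P`
        refine Or.inl ⟨Fin.castAdd 1 j, ?_⟩
        simp only [P, Fin.append_left, hθv, sub_eq_add_neg]
      · -- point `p j - v`: either `j = i₀` (reflected extra point of `P`) or in `Q`
        by_cases hj : j = i₀
        · subst hj
          refine Or.inl ⟨Fin.natAdd (m + 1) 0, ?_⟩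
          simp only [P, Fin.append_right, hθθv, sub_eq_add_neg]
        · obtain ⟨z, hz⟩ := Fin.exists_succAbove_eq hj
          refine Or.inr ⟨z, ?_⟩
          simp only [Q, hz, Fin.append_right, sub_eq_add_neg]
    · rintro (⟨i, rfl⟩ | ⟨j, rfl⟩)
      · refine Fin.addCases (fun j => ?_) (fun j => ?_) i
        · refine ⟨Fin.castAdd (m + 1) j, ?_⟩
          simp only [P, Fin.append_left, hθv, sub_eq_add_neg]
        · refine ⟨Fin.natAdd (m + 1) i₀, ?_⟩
          simp only [P, Fin.append_right, hθθv, sub_eq_add_neg]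
      · refine ⟨Fin.natAdd (m + 1) (i₀.succAbove j), ?_⟩
        simp only [Q, Fin.append_right, sub_eq_add_neg]
  calc osPointKernel S ⟨m + 1, p, hpinj, hpos⟩ ⟨m + 1, p, hpinj, hpos⟩
      = S ((m + 1) + (m + 1)) (fun i => Fin.append (fun i => axisReflection τ (p i)) p i + (-v)) :=
        (hT _ (-v) _).symm
    _ = S (P.n + Q.n) (Fin.append (fun i => axisReflection τ (P.pts i)) Q.pts) :=
        corr_eq_of_range_eq hP hy hz hrange
    _ = 0 := hzero

/-- **Reflection positivity forces every even order to be non-zero.** If `S` is OS-positive along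
`τ`, reflection invariant, permutation symmetric, translation invariant and has a non-degenerate
two-point function, then for every `k ≥ 1` the `2k`-point function does not vanish identically on
non-coincident configurations (indeed some OS diagonal entry `S_{2k}(θa ⊔ a)` is non-zero). In
particular NO family with finitely many non-zero orders (`narrowFamily`, `sixFamily`, any truncated
perturbation of a Gaussian) is reflection positive. [folklore] -/
theorem even_order_ne_zero_of_reflectionPositive {S : CorrFamily d} (hRP : IsReflectionPositiveAlong τ S)
    (hR : IsReflectionInvariantAlong τ S) (hP : IsPermutationSymmetric S) (hT : IsTranslationInvariant S)
    (hnd : IsNondegenerateTwoPoint S) (k : ℕ) (hk : 1 ≤ k) :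
    ¬ ∀ x ∈ NonCoincident d (k + k), S (k + k) x = 0 := by
  intro hzero
  -- rows of `k`-point configurations vanish
  have hrowk : ∀ a : HalfSpaceConfig d τ, a.n = k → Injective (fun i => a.pts i τ) →
      ∀ b : HalfSpaceConfig d τ, osPointKernel S a b = 0 := by
    intro a hak _ b
    refine osPointKernel_eq_zero_of_self_eq_zero hRP hR hP ?_ b
    obtain ⟨n, p, hp, hpos⟩ := a
    simp only at hak
    subst hak
    exact hzero _ (osPointKernel_arg_injective ⟨n, p, hp, hpos⟩ ⟨n, p, hp, hpos⟩)
  -- descend to `k = 1`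
  have hdesc : ∀ e j, 1 ≤ j → j + e = k → ∀ a : HalfSpaceConfig d τ, a.n = j →
      Injective (fun i => a.pts i τ) → ∀ b : HalfSpaceConfig d τ, osPointKernel S a b = 0 := by
    intro e
    induction e with
    | zero =>
      intro j _ hjk
      have : j = k := by omega
      subst this
      exact hrowk
    | succ e ih =>
      intro j hj1 hjk a haj hainj b
      have hrow' := ih (j + 1) (by omega) (by omega)
      exact osPointKernel_eq_zero_of_self_eq_zero hRP hR hP
        (osPointKernel_self_eq_zero_down hP hT hrow' a haj hj1 hainj) b
  have h1 := hdesc (k - 1) 1 le_rfl (by omega)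
  -- contradiction with non-degeneracy at `(θ e_τ, e_τ)`
  let a : HalfSpaceConfig d τ :=
    { n := 1
      pts := fun _ => EuclideanSpace.single τ 1
      injective := Function.injective_of_subsingleton _
      pos := fun _ => by simp }
  have hK := h1 a rfl (Function.injective_of_subsingleton _) a
  have hpos : 0 < osPointKernel S a a := hnd _ (osPointKernel_arg_injective a a)
  exact hpos.ne' hK


/-- The same with `2 * k`. [folklore] -/
theorem two_mul_order_ne_zero_of_reflectionPositive {S : CorrFamily d} (hRP : IsReflectionPositiveAlong τ S)
    (hR : IsReflectionInvariantAlong τ S) (hP : IsPermutationSymmetric S) (hT : IsTranslationInvariant S)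
    (hnd : IsNondegenerateTwoPoint S) (k : ℕ) (hk : 1 ≤ k) :
    ¬ ∀ x ∈ NonCoincident d (2 * k), S (2 * k) x = 0 := by
  have h := even_order_ne_zero_of_reflectionPositive hRP hR hP hT hnd k hk
  rwa [← two_mul] at h

/-- Corollary in the shape of the OS premises bundle: a family admitting the pointwise OS
reconstruction along some axis and having a non-degenerate two-point function has all even orders
non-zero; contrapositively, a family with SOME identically vanishing even order `2k ≥ 2` (on
non-coincident configurations) admits no pointwise OS reconstruction along any axis. [folklore] -/
theorem not_pointwiseOSReconstruction_of_even_order_eq_zero {S : CorrFamily d}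
    (hnd : IsNondegenerateTwoPoint S) {k : ℕ} (hk : 1 ≤ k)
    (hzero : ∀ x ∈ NonCoincident d (k + k), S (k + k) x = 0) (τ : Fin d) :
    ¬ PointwiseOSReconstruction τ S := fun h =>
  even_order_ne_zero_of_reflectionPositive h.reflectionPositive h.reflectionInvariant h.symmetric
    h.translationInvariant hnd k hk hzero


end RPOrders

/-- In particular the two model-blind witnesses of this file are not RP for a UNIFORM reason
(`narrowFamily`: `S₆ ≡ 0`; `sixFamily`: `S₈ ≡ 0`), and any reflection-positive decoy for §7' must
have every even order non-zero. [folklore] -/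
theorem sixFamily_not_pointwiseOSReconstruction (Δ : ℝ) (τ : Fin 3) :
    ¬ PointwiseOSReconstruction τ (SixPt.sixFamily Δ) :=
  not_pointwiseOSReconstruction_of_even_order_eq_zero (SixPt.sixFamily_isNondegenerateTwoPoint Δ)
    (k := 4) (by norm_num) (fun _ _ => rfl) τ

/-! ## §8 DOWNWARD RIGIDITY UNDER RP (cycle 3; tree `Negative/DownwardRigidity.lean` p74911, `DownwardRigidityWickFour.lean`,
`WickEight.lean`, `DownwardRigidityWickEight.lean`)

The `2n`-point function pins the `n`-point function up to one constant under reflection positivity +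
clustering; Gaussian instance `(2,4)` here in full; the `(4,8)` instance (`S₈` Gaussian ⇒ `S₄ = γ·wick`
⇒ inversion identity at order four, `invIdentity_four_of_wick_eight`) is the tree file
`DownwardRigidityWickEight.lean` (with `WickEight.lean`: 105-matching bookkeeping generated
mechanically, not mirrored here). Mirrors the tree files verbatim (namespace apart). -/

section DownwardRigidity

variable {d : ℕ} {τ : Fin d}

/-! ## The discriminant lemmas -/

/-- If `t² + 2tsp + s²r ≥ 0` for all real `t, s`, then `p² ≤ r`. [folklore] -/
theorem sq_le_of_forall_quadratic_nonneg {p r : ℝ}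
    (h : ∀ t s : ℝ, 0 ≤ t ^ 2 + 2 * t * s * p + s ^ 2 * r) : p ^ 2 ≤ r := by
  have := h (-p) 1
  nlinarith

/-- If `A t² + 2tp ≥ 0` for all real `t`, then `p = 0`. [folklore] -/
theorem eq_zero_of_forall_quadratic_nonneg {A p : ℝ} (h : ∀ t : ℝ, 0 ≤ A * t ^ 2 + 2 * t * p) :
    p = 0 := by
  by_contra hp
  have hp2 : 0 < p ^ 2 := by positivity
  rcases le_or_gt A 0 with hA | hA
  · have := h (-p)
    nlinarith
  · have := h (-p / A)
    have e : A * (-p / A) ^ 2 + 2 * (-p / A) * p = -(p ^ 2) / A := by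
      field_simp; ring
    rw [e] at this
    have : 0 < p ^ 2 / A := div_pos hp2 hA
    have : -(p ^ 2) / A = -(p ^ 2 / A) := by ring
    linarith

/-! ## Three-configuration reflection positivity -/

/-- The symmetrised OS kernel `(K(a,b) + K(b,a))/2` (only the symmetric part of the OS matrix
enters the quadratic form of `IsReflectionPositiveAlong`). [folklore] -/
def osSym (S : CorrFamily d) (a b : HalfSpaceConfig d τ) : ℝ :=
  (osPointKernel S a b + osPointKernel S b a) / 2

/-- `osSym` on the diagonal is the OS kernel. [folklore] -/
theorem osSym_self (S : CorrFamily d) (a : HalfSpaceConfig d τ) : osSym S a a = osPointKernel S a a := by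
  unfold osSym; ring

/-- `osSym` is symmetric. [folklore] -/
theorem osSym_comm (S : CorrFamily d) (a b : HalfSpaceConfig d τ) : osSym S a b = osSym S b a := by
  unfold osSym; ring

/-- **Reflection positivity on three configurations**, written out. [folklore] -/
theorem rp_three {S : CorrFamily d} (hRP : IsReflectionPositiveAlong τ S)
    (a₀ a₁ a₂ : HalfSpaceConfig d τ) (c₀ c₁ c₂ : ℝ) :
    0 ≤ c₀ ^ 2 * osPointKernel S a₀ a₀ + c₁ ^ 2 * osPointKernel S a₁ a₁ + c₂ ^ 2 * osPointKernel S a₂ a₂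
      + 2 * c₀ * c₁ * osSym S a₀ a₁ + 2 * c₀ * c₂ * osSym S a₀ a₂ + 2 * c₁ * c₂ * osSym S a₁ a₂ := by
  have h := hRP 3 ![a₀, a₁, a₂] ![c₀, c₁, c₂]
  simp only [Fin.sum_univ_three, Matrix.cons_val_zero, Matrix.cons_val_one,
    Matrix.cons_val_two, Matrix.head_cons, Matrix.tail_cons] at h
  calc (0 : ℝ) ≤ c₀ * c₀ * osPointKernel S a₀ a₀ + c₀ * c₁ * osPointKernel S a₀ a₁
        + c₀ * c₂ * osPointKernel S a₀ a₂
      + (c₁ * c₀ * osPointKernel S a₁ a₀ + c₁ * c₁ * osPointKernel S a₁ a₁ + c₁ * c₂ * osPointKernel S a₁ a₂)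
      + (c₂ * c₀ * osPointKernel S a₂ a₀ + c₂ * c₁ * osPointKernel S a₂ a₁ + c₂ * c₂ * osPointKernel S a₂ a₂) := h
    _ = _ := by unfold osSym; ring

/-- **The downward step (finite form).** For the empty configuration `∅` (`S₀`-entry `K(∅,∅) = 1`)
and two half-space configurations `a, b` with normalisers `rₐ, r_b ≠ 0`:
`(σ(a)/rₐ - σ(b)/r_b)² ≤ K(a,a)/rₐ² - 2σ(a,b)/(rₐ r_b) + K(b,b)/r_b²`, where `σ(a) = osSym S ∅ a`
(`= S_n(a)` for a reflection-invariant family) — positivity of the OS Gram matrix of `(∅, a, b)`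
with coefficients `(t, s/rₐ, -s/r_b)`. [folklore] -/
theorem downward_step {S : CorrFamily d} (hRP : IsReflectionPositiveAlong τ S)
    (h0 : osPointKernel S (HalfSpaceConfig.empty d τ) (HalfSpaceConfig.empty d τ) = 1)
    (a b : HalfSpaceConfig d τ) {ra rb : ℝ} (hra : ra ≠ 0) (hrb : rb ≠ 0) :
    (osSym S (HalfSpaceConfig.empty d τ) a / ra - osSym S (HalfSpaceConfig.empty d τ) b / rb) ^ 2 ≤
      osPointKernel S a a / ra ^ 2 - 2 * osSym S a b / (ra * rb) + osPointKernel S b b / rb ^ 2 := by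
  apply sq_le_of_forall_quadratic_nonneg
  intro t s
  have h := rp_three hRP (HalfSpaceConfig.empty d τ) a b t (s / ra) (-(s / rb))
  rw [h0] at h
  calc (0 : ℝ) ≤ _ := h
    _ = _ := by field_simp; ring

/-- **Cauchy–Schwarz with the vacuum (finite form).** `(σ(a)/rₐ)² ≤ K(a,a)/rₐ²`. [folklore] -/
theorem ratio_sq_le {S : CorrFamily d} (hRP : IsReflectionPositiveAlong τ S)
    (h0 : osPointKernel S (HalfSpaceConfig.empty d τ) (HalfSpaceConfig.empty d τ) = 1)
    (a : HalfSpaceConfig d τ) {ra : ℝ} (hra : ra ≠ 0) :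
    (osSym S (HalfSpaceConfig.empty d τ) a / ra) ^ 2 ≤ osPointKernel S a a / ra ^ 2 := by
  apply sq_le_of_forall_quadratic_nonneg
  intro t s
  have h := rp_three hRP (HalfSpaceConfig.empty d τ) a a t (s / ra) 0
  rw [h0] at h
  calc (0 : ℝ) ≤ _ := h
    _ = _ := by field_simp; ring

/-! ## Pushing configurations away from the mirror: `HalfSpaceConfig.timeShift` -/

/-- **DOWNWARD RIGIDITY (limit form).** Let `S` be reflection positive along `τ` with `K(∅,∅) = 1`.
If for two half-space configurations `a, b` and normalisers `rₐ, r_b ≠ 0` the vacuum rows do not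
move under the time translation `T(L)` (`σ(∅, a_L) = σ(∅, a)`, `σ(∅, b_L) = σ(∅, b)`, `L ≥ 0`) while
the `2n`-point entries CLUSTER, `K(a_L,a_L) → rₐ²`, `σ(a_L,b_L) → rₐ r_b`, `K(b_L,b_L) → r_b²` as
`L → ∞`, then `σ(∅,a)/rₐ = σ(∅,b)/r_b`. (The right-hand side of `downward_step` tends to
`1 - 2 + 1 = 0` while the left-hand side is constant.) In words: under RP the `2n`-point function
pins the `n`-point function up to ONE multiplicative constant. [folklore] -/
theorem downward_rigidity {S : CorrFamily d} (hRP : IsReflectionPositiveAlong τ S)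
    (h0 : osPointKernel S (HalfSpaceConfig.empty d τ) (HalfSpaceConfig.empty d τ) = 1)
    (a b : HalfSpaceConfig d τ) {ra rb : ℝ} (hra : ra ≠ 0) (hrb : rb ≠ 0)
    (hσa : ∀ L : ℝ, 0 ≤ L →
      osSym S (HalfSpaceConfig.empty d τ) (a.timeShift L) = osSym S (HalfSpaceConfig.empty d τ) a)
    (hσb : ∀ L : ℝ, 0 ≤ L →
      osSym S (HalfSpaceConfig.empty d τ) (b.timeShift L) = osSym S (HalfSpaceConfig.empty d τ) b)
    (hA : Tendsto (fun L => osPointKernel S (a.timeShift L) (a.timeShift L)) atTop (𝓝 (ra ^ 2)))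
    (hB : Tendsto (fun L => osSym S (a.timeShift L) (b.timeShift L)) atTop (𝓝 (ra * rb)))
    (hC : Tendsto (fun L => osPointKernel S (b.timeShift L) (b.timeShift L)) atTop (𝓝 (rb ^ 2))) :
    osSym S (HalfSpaceConfig.empty d τ) a / ra = osSym S (HalfSpaceConfig.empty d τ) b / rb := by
  set P := osSym S (HalfSpaceConfig.empty d τ) a / ra - osSym S (HalfSpaceConfig.empty d τ) b / rb
    with hP
  have hR : Tendsto (fun L => osPointKernel S (a.timeShift L) (a.timeShift L) / ra ^ 2
      - 2 * osSym S (a.timeShift L) (b.timeShift L) / (ra * rb)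
      + osPointKernel S (b.timeShift L) (b.timeShift L) / rb ^ 2) atTop
      (𝓝 (ra ^ 2 / ra ^ 2 - 2 * (ra * rb) / (ra * rb) + rb ^ 2 / rb ^ 2)) :=
    ((hA.div_const _).sub ((hB.const_mul 2).div_const _)).add (hC.div_const _)
  have hlim : ra ^ 2 / ra ^ 2 - 2 * (ra * rb) / (ra * rb) + rb ^ 2 / rb ^ 2 = 0 := by
    field_simp; ring
  have hev : ∀ᶠ L in atTop, P ^ 2 ≤ osPointKernel S (a.timeShift L) (a.timeShift L) / ra ^ 2
      - 2 * osSym S (a.timeShift L) (b.timeShift L) / (ra * rb)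
      + osPointKernel S (b.timeShift L) (b.timeShift L) / rb ^ 2 := by
    filter_upwards [eventually_ge_atTop (0 : ℝ)] with L hL
    have := downward_step hRP h0 (a.timeShift L) (b.timeShift L) hra hrb
    rwa [hσa L hL, hσb L hL] at this
  have hP2 : P ^ 2 ≤ 0 := hlim ▸ ge_of_tendsto hR hev
  have hP0 : P = 0 := by nlinarith [sq_nonneg P]
  exact sub_eq_zero.mp hP0

/-- **`|γ| ≤ 1`.** Under the same clustering of `K(a_L,a_L)`, `(σ(∅,a)/rₐ)² ≤ 1`. [folklore] -/
theorem ratio_sq_le_one {S : CorrFamily d} (hRP : IsReflectionPositiveAlong τ S)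
    (h0 : osPointKernel S (HalfSpaceConfig.empty d τ) (HalfSpaceConfig.empty d τ) = 1)
    (a : HalfSpaceConfig d τ) {ra : ℝ} (hra : ra ≠ 0)
    (hσa : ∀ L : ℝ, 0 ≤ L →
      osSym S (HalfSpaceConfig.empty d τ) (a.timeShift L) = osSym S (HalfSpaceConfig.empty d τ) a)
    (hA : Tendsto (fun L => osPointKernel S (a.timeShift L) (a.timeShift L)) atTop (𝓝 (ra ^ 2))) :
    (osSym S (HalfSpaceConfig.empty d τ) a / ra) ^ 2 ≤ 1 := by
  have hR : Tendsto (fun L => osPointKernel S (a.timeShift L) (a.timeShift L) / ra ^ 2) atTop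
      (𝓝 (ra ^ 2 / ra ^ 2)) := hA.div_const _
  have hlim : ra ^ 2 / ra ^ 2 = 1 := by field_simp
  have hev : ∀ᶠ L in atTop, (osSym S (HalfSpaceConfig.empty d τ) a / ra) ^ 2 ≤
      osPointKernel S (a.timeShift L) (a.timeShift L) / ra ^ 2 := by
    filter_upwards [eventually_ge_atTop (0 : ℝ)] with L hL
    have := ratio_sq_le hRP h0 (a.timeShift L) hra
    rwa [hσa L hL] at this
  exact hlim ▸ ge_of_tendsto hR hev

/-! ## Reading the vacuum row: `σ(a) = S_n(a)` for translation- and reflection-invariant families -/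

/-- `K(∅, a) = S_n(a)`. [folklore] -/
theorem osPointKernel_empty_left (S : CorrFamily d) (a : HalfSpaceConfig d τ) :
    osPointKernel S (HalfSpaceConfig.empty d τ) a = S a.n a.pts := by
  unfold osPointKernel
  rw [Fin.append_left_nil _ _ (show (HalfSpaceConfig.empty d τ).n = 0 from rfl)]
  exact corrFamily_comp_cast S _ a.pts

/-- `K(a, ∅) = S_n(θ a)`. [folklore] -/
theorem osPointKernel_empty_right (S : CorrFamily d) (a : HalfSpaceConfig d τ) :
    osPointKernel S a (HalfSpaceConfig.empty d τ) = S a.n (fun i => axisReflection τ (a.pts i)) := by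
  unfold osPointKernel
  rw [Fin.append_right_nil _ _ (show (HalfSpaceConfig.empty d τ).n = 0 from rfl)]
  exact corrFamily_comp_cast S _ _

/-- `K(∅, ∅) = S₀`. [folklore] -/
theorem osPointKernel_empty_empty (S : CorrFamily d) (h0 : ∀ x, S 0 x = 1) :
    osPointKernel S (HalfSpaceConfig.empty d τ) (HalfSpaceConfig.empty d τ) = 1 := by
  rw [osPointKernel_empty_left]; exact h0 _

/-- For a reflection-invariant family the vacuum row is `σ(a) = S_n(a)`. [folklore] -/
theorem osSym_empty (S : CorrFamily d) (hR : IsReflectionInvariantAlong τ S) (a : HalfSpaceConfig d τ) :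
    osSym S (HalfSpaceConfig.empty d τ) a = S a.n a.pts := by
  unfold osSym
  rw [osPointKernel_empty_left, osPointKernel_empty_right, hR]
  ring

/-- … and it does not move under the time translation `T(L)`, `L ≥ 0`, if the family is
translation invariant. [folklore] -/
theorem osSym_empty_timeShift (S : CorrFamily d) (hT : IsTranslationInvariant S)
    (hR : IsReflectionInvariantAlong τ S) (a : HalfSpaceConfig d τ) {L : ℝ} (hL : 0 ≤ L) :
    osSym S (HalfSpaceConfig.empty d τ) (a.timeShift L) = osSym S (HalfSpaceConfig.empty d τ) a := by
  rw [HalfSpaceConfig.timeShift_of_nonneg hL, osSym_empty S hR, osSym_empty S hR]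
  show S a.n (fun i => a.pts i + EuclideanSpace.single τ L) = S a.n a.pts
  exact hT a.n _ a.pts

/-! ### Degenerate one-point vectors freeze the OS rows (used in §9) -/

/-- **Degenerate one-point vectors freeze the OS rows.** If two one-point (or any) configurations
`x, y` have `K(x,x) = σ(x,y) = K(y,y)`, then `σ(x, b) = σ(y, b)` for every configuration `b`:
the OS vectors of `x` and `y` coincide (OS Gram matrix of `(x, y, b)` with coefficients
`(c, -c, t)`). [folklore] -/
theorem osSym_row_eq_of_degenerate {S : CorrFamily d} (hRP : IsReflectionPositiveAlong τ S)
    (x y b : HalfSpaceConfig d τ) {k : ℝ} (hxx : osPointKernel S x x = k) (hyy : osPointKernel S y y = k)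
    (hxy : osSym S x y = k) : osSym S x b = osSym S y b := by
  have h : ∀ t : ℝ, 0 ≤ osPointKernel S b b * t ^ 2 + 2 * t * (osSym S x b - osSym S y b) := by
    intro t
    have := rp_three hRP x y b 1 (-1) t
    rw [hxx, hyy, hxy] at this
    nlinarith
  exact sub_eq_zero.mp (eq_zero_of_forall_quadratic_nonneg h)

end DownwardRigidity

section Gaussian

variable {τ : Fin 3}

local notation "E³" => EuclideanSpace ℝ (Fin 3)

/-- The two-point half-space configuration `(p, q)`. [folklore] -/
def cfg2 (p q : E³) (hp : 0 < p τ) (hq : 0 < q τ) (hpq : p ≠ q) : HalfSpaceConfig 3 τ where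
  n := 2
  pts := ![p, q]
  injective := by
    intro i j hij
    fin_cases i <;> fin_cases j
    · rfl
    · exact absurd hij hpq
    · exact absurd hij.symm hpq
    · rfl
  pos := fun i => by fin_cases i <;> simpa

/-- `Fin.append` of two pairs as a vector literal. [folklore] -/
theorem fin_append_two_two {α : Type*} (f g : Fin 2 → α) :
    Fin.append f g = ![f 0, f 1, g 0, g 1] := by
  funext i
  fin_cases i <;> rfl

/-- The OS entry of two (time-shifted, `L ≥ 0`) two-point configurations is a value of `S₄`. [folklore] -/
theorem osPointKernel_cfg2 (S : CorrFamily 3) {p q u v : E³} (hp : 0 < p τ) (hq : 0 < q τ)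
    (hpq : p ≠ q) (hu : 0 < u τ) (hv : 0 < v τ) (huv : u ≠ v) {L : ℝ} (hL : 0 ≤ L) :
    osPointKernel S ((cfg2 p q hp hq hpq).timeShift L) ((cfg2 u v hu hv huv).timeShift L) =
      S 4 ![axisReflection τ (p + EuclideanSpace.single τ L),
        axisReflection τ (q + EuclideanSpace.single τ L),
        u + EuclideanSpace.single τ L, v + EuclideanSpace.single τ L] := by
  rw [HalfSpaceConfig.timeShift_of_nonneg hL, HalfSpaceConfig.timeShift_of_nonneg hL]
  show S 4 (Fin.append (fun i => axisReflection τ (![p, q] i + EuclideanSpace.single τ L))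
      (fun i => ![u, v] i + EuclideanSpace.single τ L)) = _
  rw [fin_append_two_two]
  rfl

/-- The argument of that `S₄` is non-coincident. [folklore] -/
theorem cfg2_arg_injective {p q u v : E³} (hp : 0 < p τ) (hq : 0 < q τ)
    (hpq : p ≠ q) (hu : 0 < u τ) (hv : 0 < v τ) (huv : u ≠ v) {L : ℝ} (hL : 0 ≤ L) :
    Function.Injective ![axisReflection τ (p + EuclideanSpace.single τ L),
        axisReflection τ (q + EuclideanSpace.single τ L),
        u + EuclideanSpace.single τ L, v + EuclideanSpace.single τ L] := by
  have h := osPointKernel_arg_injective ((cfg2 p q hp hq hpq).timeShift L) ((cfg2 u v hu hv huv).timeShift L)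
  rw [HalfSpaceConfig.timeShift_of_nonneg hL, HalfSpaceConfig.timeShift_of_nonneg hL] at h
  change Function.Injective (Fin.append
      (fun i => axisReflection τ (![p, q] i + EuclideanSpace.single τ L))
      (fun i => ![u, v] i + EuclideanSpace.single τ L)) at h
  rw [fin_append_two_two] at h
  simpa using h

/-- Internal factors do not move: `twoPt Δ (θ(x+Le)) (θ(y+Le)) = twoPt Δ x y`. [folklore] -/
theorem twoPt_reflect_shift (Δ : ℝ) (x y : E³) (L : ℝ) :
    twoPt Δ (axisReflection τ (x + EuclideanSpace.single τ L))
      (axisReflection τ (y + EuclideanSpace.single τ L)) = twoPt Δ x y := by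
  rw [twoPt_map, twoPt_add]

/-- Internal factors do not move: `twoPt Δ (x+Le) (y+Le) = twoPt Δ x y`. [folklore] -/
theorem twoPt_shift (Δ : ℝ) (x y : E³) (L : ℝ) :
    twoPt Δ (x + EuclideanSpace.single τ L) (y + EuclideanSpace.single τ L) = twoPt Δ x y :=
  twoPt_add Δ x y _

/-- **Cross factors die**: `twoPt Δ (θ(x + Le_τ)) (y + Le_τ) → 0` as `L → ∞` (`Δ > 0`): the two
points separate by at least `2L - ‖θx - y‖`. [folklore] -/
theorem tendsto_twoPt_cross {Δ : ℝ} (hΔ : 0 < Δ) (x y : E³) :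
    Tendsto (fun L : ℝ => twoPt Δ (axisReflection τ (x + EuclideanSpace.single τ L))
      (y + EuclideanSpace.single τ L)) atTop (𝓝 0) := by
  -- lower bound on the separation
  have hsep : ∀ L : ℝ, 2 * L - ‖axisReflection τ x - y‖ ≤
      ‖axisReflection τ (x + EuclideanSpace.single τ L) - (y + EuclideanSpace.single τ L)‖ := by
    intro L
    rw [axisReflection_add_single]
    have e : axisReflection τ x - EuclideanSpace.single τ L - (y + EuclideanSpace.single τ L)
        = (axisReflection τ x - y) - (2 : ℝ) • EuclideanSpace.single τ L := by
      rw [two_smul]; abel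
    rw [e]
    have h1 := norm_sub_norm_le ((2 : ℝ) • EuclideanSpace.single τ L) (axisReflection τ x - y)
    have h2 : ‖(2 : ℝ) • EuclideanSpace.single τ L‖ = 2 * |L| := by
      rw [norm_smul, PiLp.norm_single, Real.norm_eq_abs, Real.norm_eq_abs, abs_of_pos two_pos]
    have h3 : L ≤ |L| := le_abs_self L
    have h4 : ‖(2 : ℝ) • EuclideanSpace.single τ L - (axisReflection τ x - y)‖ =
        ‖axisReflection τ x - y - (2 : ℝ) • EuclideanSpace.single τ L‖ := norm_sub_rev _ _
    linarith
  have hnorm : Tendsto (fun L : ℝ => ‖axisReflection τ (x + EuclideanSpace.single τ L)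
      - (y + EuclideanSpace.single τ L)‖) atTop atTop := by
    refine tendsto_atTop_mono hsep ?_
    have : Tendsto (fun L : ℝ => 2 * L) atTop atTop := Tendsto.const_mul_atTop two_pos tendsto_id
    exact tendsto_atTop_add_const_right atTop (-‖axisReflection τ x - y‖) this
  have h := (tendsto_rpow_neg_atTop (by linarith : 0 < 2 * Δ)).comp hnorm
  simpa [twoPt, Function.comp_def] using h

/-- **The Gaussian OS clustering at orders `(2,4)`.** If `S₄ = wick Δ` on non-coincident
configurations, then `K(a_L, b_L) → twoPt(a) · twoPt(b)` for two-point configurations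
`a = (p,q)`, `b = (u,v)`. [folklore] -/
theorem tendsto_osPointKernel_cfg2 {S : CorrFamily 3} {Δ : ℝ} (hΔ : 0 < Δ)
    (h4 : ∀ x : Fin 4 → E³, Function.Injective x → S 4 x = wick Δ x)
    {p q u v : E³} (hp : 0 < p τ) (hq : 0 < q τ) (hpq : p ≠ q) (hu : 0 < u τ) (hv : 0 < v τ) (huv : u ≠ v) :
    Tendsto (fun L => osPointKernel S ((cfg2 p q hp hq hpq).timeShift L) ((cfg2 u v hu hv huv).timeShift L))
      atTop (𝓝 (twoPt Δ p q * twoPt Δ u v)) := by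
  have hev : ∀ᶠ L in atTop,
      twoPt Δ p q * twoPt Δ u v
        + twoPt Δ (axisReflection τ (p + EuclideanSpace.single τ L)) (u + EuclideanSpace.single τ L)
          * twoPt Δ (axisReflection τ (q + EuclideanSpace.single τ L)) (v + EuclideanSpace.single τ L)
        + twoPt Δ (axisReflection τ (p + EuclideanSpace.single τ L)) (v + EuclideanSpace.single τ L)
          * twoPt Δ (axisReflection τ (q + EuclideanSpace.single τ L)) (u + EuclideanSpace.single τ L)
      = osPointKernel S ((cfg2 p q hp hq hpq).timeShift L) ((cfg2 u v hu hv huv).timeShift L) := by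
    filter_upwards [eventually_ge_atTop (0 : ℝ)] with L hL
    rw [osPointKernel_cfg2 S hp hq hpq hu hv huv hL, h4 _ (cfg2_arg_injective hp hq hpq hu hv huv hL)]
    simp only [wick, Matrix.cons_val_zero, Matrix.cons_val_one, Matrix.head_cons, Matrix.cons_val_two,
      Matrix.cons_val_three, Matrix.tail_cons, twoPt_reflect_shift, twoPt_shift]
  have h := ((tendsto_const_nhds (x := twoPt Δ p q * twoPt Δ u v)).add
    ((tendsto_twoPt_cross hΔ p u (τ := τ)).mul (tendsto_twoPt_cross hΔ q v (τ := τ)))).add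
    ((tendsto_twoPt_cross hΔ p v (τ := τ)).mul (tendsto_twoPt_cross hΔ q u (τ := τ)))
  simp only [mul_zero, add_zero] at h
  exact h.congr' hev

/-- Symmetrised version. [folklore] -/
theorem tendsto_osSym_cfg2 {S : CorrFamily 3} {Δ : ℝ} (hΔ : 0 < Δ)
    (h4 : ∀ x : Fin 4 → E³, Function.Injective x → S 4 x = wick Δ x)
    {p q u v : E³} (hp : 0 < p τ) (hq : 0 < q τ) (hpq : p ≠ q) (hu : 0 < u τ) (hv : 0 < v τ) (huv : u ≠ v) :
    Tendsto (fun L => osSym S ((cfg2 p q hp hq hpq).timeShift L) ((cfg2 u v hu hv huv).timeShift L))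
      atTop (𝓝 (twoPt Δ p q * twoPt Δ u v)) := by
  have h := ((tendsto_osPointKernel_cfg2 hΔ h4 hp hq hpq hu hv huv (τ := τ)).add
    (tendsto_osPointKernel_cfg2 hΔ h4 hu hv huv hp hq hpq (τ := τ))).div_const 2
  have e : (twoPt Δ p q * twoPt Δ u v + twoPt Δ u v * twoPt Δ p q) / 2 = twoPt Δ p q * twoPt Δ u v := by
    ring
  rw [e] at h
  exact h

/-- **DOWNWARD RIGIDITY, Gaussian instance at orders `(2,4)`.** A reflection-positive (along one
axis), translation- and reflection-invariant family on `ℝ³` with `S₀ = 1` whose four-point function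
is the Wick function `wick Δ` of `twoPt Δ` (`Δ > 0`) has `S₂(p,q)/twoPt Δ p q` CONSTANT over pairs in
the half-space. [folklore] -/
theorem wick_downward_two {S : CorrFamily 3} {Δ : ℝ} (hΔ : 0 < Δ)
    (hRP : IsReflectionPositiveAlong τ S) (hT : IsTranslationInvariant S)
    (hR : IsReflectionInvariantAlong τ S) (h0 : ∀ x, S 0 x = 1)
    (h4 : ∀ x : Fin 4 → E³, Function.Injective x → S 4 x = wick Δ x)
    {p q u v : E³} (hp : 0 < p τ) (hq : 0 < q τ) (hpq : p ≠ q) (hu : 0 < u τ) (hv : 0 < v τ) (huv : u ≠ v) :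
    S 2 ![p, q] / twoPt Δ p q = S 2 ![u, v] / twoPt Δ u v := by
  have key := downward_rigidity hRP (osPointKernel_empty_empty S h0)
    (cfg2 p q hp hq hpq) (cfg2 u v hu hv huv) (twoPt_pos Δ hpq).ne' (twoPt_pos Δ huv).ne'
    (fun L hL => osSym_empty_timeShift S hT hR _ hL) (fun L hL => osSym_empty_timeShift S hT hR _ hL)
    (by simpa [sq] using tendsto_osPointKernel_cfg2 hΔ h4 hp hq hpq hp hq hpq (τ := τ))
    (tendsto_osSym_cfg2 hΔ h4 hp hq hpq hu hv huv)
    (by simpa [sq] using tendsto_osPointKernel_cfg2 hΔ h4 hu hv huv hu hv huv (τ := τ))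
  rwa [osSym_empty S hR, osSym_empty S hR] at key

/-- … and the constant has modulus at most `1`. [folklore] -/
theorem wick_ratio_sq_le_one {S : CorrFamily 3} {Δ : ℝ} (hΔ : 0 < Δ)
    (hRP : IsReflectionPositiveAlong τ S) (hT : IsTranslationInvariant S)
    (hR : IsReflectionInvariantAlong τ S) (h0 : ∀ x, S 0 x = 1)
    (h4 : ∀ x : Fin 4 → E³, Function.Injective x → S 4 x = wick Δ x)
    {p q : E³} (hp : 0 < p τ) (hq : 0 < q τ) (hpq : p ≠ q) :
    (S 2 ![p, q] / twoPt Δ p q) ^ 2 ≤ 1 := by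
  have key := ratio_sq_le_one hRP (osPointKernel_empty_empty S h0) (cfg2 p q hp hq hpq)
    (twoPt_pos Δ hpq).ne' (fun L hL => osSym_empty_timeShift S hT hR _ hL)
    (by simpa [sq] using tendsto_osPointKernel_cfg2 hΔ h4 hp hq hpq hp hq hpq (τ := τ))
  rwa [osSym_empty S hR] at key

/-- **Corollary: `S₂ = γ · twoPt Δ` on ALL non-coincident pairs, `γ ∈ [-1,1]`** (translate any
pair into the half-space). [folklore] -/
theorem exists_gamma_two_point_of_wick_four {S : CorrFamily 3} {Δ : ℝ} (hΔ : 0 < Δ) (τ : Fin 3)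
    (hRP : IsReflectionPositiveAlong τ S) (hT : IsTranslationInvariant S)
    (hR : IsReflectionInvariantAlong τ S) (h0 : ∀ x, S 0 x = 1)
    (h4 : ∀ x : Fin 4 → E³, Function.Injective x → S 4 x = wick Δ x) :
    ∃ γ : ℝ, γ ^ 2 ≤ 1 ∧ ∀ p q : E³, p ≠ q → S 2 ![p, q] = γ * twoPt Δ p q := by
  -- reference pair in the half-space
  set e : E³ := EuclideanSpace.single τ 1 with he
  have he1 : 0 < e τ := by simp [he]
  have he2 : 0 < ((2 : ℝ) • e) τ := by simp [he]
  have hne : e ≠ (2 : ℝ) • e := by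
    intro h
    have := congrArg (fun z : E³ => z τ) h
    simp [he] at this
  refine ⟨S 2 ![e, (2 : ℝ) • e] / twoPt Δ e ((2 : ℝ) • e), wick_ratio_sq_le_one hΔ hRP hT hR h0 h4 he1 he2 hne, ?_⟩
  intro p q hpq
  -- translate (p, q) up by `t e_τ`, `t = 1 + |p τ| + |q τ|`
  set t : ℝ := 1 + |p τ| + |q τ| with ht
  set w : E³ := EuclideanSpace.single τ t with hw
  have hp' : 0 < (p + w) τ := by
    simp only [PiLp.add_apply, hw, PiLp.single_apply, if_true]
    have := neg_abs_le (p τ); have := abs_nonneg (q τ); linarith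
  have hq' : 0 < (q + w) τ := by
    simp only [PiLp.add_apply, hw, PiLp.single_apply, if_true]
    have := neg_abs_le (q τ); have := abs_nonneg (p τ); linarith
  have hpq' : p + w ≠ q + w := fun h => hpq (add_right_cancel h)
  have key := wick_downward_two hΔ hRP hT hR h0 h4 hp' hq' hpq' he1 he2 hne
  have hS : S 2 ![p + w, q + w] = S 2 ![p, q] := by
    have e1 : (fun i => (![p, q] : Fin 2 → E³) i + w) = ![p + w, q + w] := by
      funext i; fin_cases i <;> rfl
    rw [← e1]
    exact hT 2 w ![p, q]
  rw [hS, twoPt_add] at key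
  rw [← key, div_mul_cancel₀ _ (twoPt_pos Δ hpq).ne']

end Gaussian

/-! ## §9 WEIGHT-`0` DRESSINGS ARE RIGID (cycle 3; tree `Negative/ScaleZeroDressing.lean`)

No Schur-product decoy `GFF_Δ ⊙ K`: a reflection-positive, Euclidean-invariant, weight-`0` family `K`
has frozen OS rows; with symmetry, `K₃(p,q,r)` does not depend on `p` off the segment `[q,r]`. -/

section ScaleZeroOpen
open scoped RealInnerProductSpace

section ScaleZero

variable {τ : Fin 3}

local notation "E³" => EuclideanSpace ℝ (Fin 3)

/-- The one-point half-space configuration `(p)`. [folklore] -/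
def cfg1 (p : E³) (hp : 0 < p τ) : HalfSpaceConfig 3 τ where
  n := 1
  pts := ![p]
  injective := Function.injective_of_subsingleton _
  pos := fun i => by fin_cases i; simpa

/-- `Fin.append` of two singletons as a vector literal. [folklore] -/
theorem fin_append_one_one {α : Type*} (f g : Fin 1 → α) : Fin.append f g = ![f 0, g 0] := by
  funext i; fin_cases i <;> rfl

/-- `Fin.append` of a singleton and a pair as a vector literal. [folklore] -/
theorem fin_append_one_two {α : Type*} (f : Fin 1 → α) (g : Fin 2 → α) :
    Fin.append f g = ![f 0, g 0, g 1] := by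
  funext i; fin_cases i <;> rfl

/-- `Fin.append` of a pair and a singleton as a vector literal. [folklore] -/
theorem fin_append_two_one {α : Type*} (f : Fin 2 → α) (g : Fin 1 → α) :
    Fin.append f g = ![f 0, f 1, g 0] := by
  funext i; fin_cases i <;> rfl

/-- A weight-`0` scale-covariant Euclidean-invariant family has a CONSTANT two-point function off
the diagonal (`two_point_eq` with `Δ = 0`). [folklore] -/
theorem two_point_const_of_scaleZero {K : CorrFamily 3} (heuc : IsEuclideanInvariant K)
    (hsc : IsScaleCovariant 0 K) {a b : E³} (hab : a ≠ b) :
    K 2 ![a, b] = K 2 ![0, EuclideanSpace.single 0 1] := by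
  have h := two_point_eq heuc hsc hab
  simpa using h

/-- **`Δ = 0` rigidity, OS form.** For a reflection-positive, Euclidean-invariant, weight-`0`
scale-covariant family `K` on `ℝ³`, the OS row of a one-point configuration does not depend on the
point: `σ((p), b) = σ((p'), b)` for all `p, p'` in the half-space and every `b`. [folklore] -/
theorem scaleZero_osSym_onePoint_eq {K : CorrFamily 3} (hRP : IsReflectionPositiveAlong τ K)
    (heuc : IsEuclideanInvariant K) (hsc : IsScaleCovariant 0 K)
    {p p' : E³} (hp : 0 < p τ) (hp' : 0 < p' τ) (b : HalfSpaceConfig 3 τ) :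
    osSym K (cfg1 p hp) b = osSym K (cfg1 p' hp') b := by
  -- all one-point OS entries equal the constant `k = K₂(0, e₀)`
  have hval : ∀ {x y : E³} (hx : 0 < x τ) (hy : 0 < y τ),
      osPointKernel K (cfg1 x hx) (cfg1 y hy) = K 2 ![0, EuclideanSpace.single 0 1] := by
    intro x y hx hy
    have hne : axisReflection τ x ≠ y := by
      intro h
      have := congrArg (fun z : E³ => z τ) h
      simp only [axisReflection_apply, if_true] at this
      linarith
    show K 2 (Fin.append (fun i => axisReflection τ ((![x] : Fin 1 → E³) i)) ![y]) = _
    rw [fin_append_one_one]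
    exact two_point_const_of_scaleZero heuc hsc hne
  refine osSym_row_eq_of_degenerate hRP (cfg1 p hp) (cfg1 p' hp') b (hval hp hp) (hval hp' hp') ?_
  unfold osSym
  rw [hval hp hp', hval hp' hp]
  ring

/-- **`Δ = 0` rigidity at order three, half-space form.** With permutation symmetry the OS row IS
`K₃`: for `p, p'` strictly below the mirror `{x_τ = 0}` and `q ≠ r` strictly above it,
`K₃(p, q, r) = K₃(p', q, r)`. [folklore] -/
theorem scaleZero_three_eq {K : CorrFamily 3} (hRP : IsReflectionPositiveAlong τ K)
    (heuc : IsEuclideanInvariant K) (hsc : IsScaleCovariant 0 K) (hP : IsPermutationSymmetric K)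
    {p p' q r : E³} (hp : p τ < 0) (hp' : p' τ < 0) (hq : 0 < q τ) (hr : 0 < r τ) (hqr : q ≠ r) :
    K 3 ![p, q, r] = K 3 ![p', q, r] := by
  have hθp : 0 < (axisReflection τ p) τ := by simp; linarith
  have hθp' : 0 < (axisReflection τ p') τ := by simp; linarith
  have key := scaleZero_osSym_onePoint_eq hRP heuc hsc hθp hθp' (cfg2 q r hq hr hqr)
  -- unfold both OS rows: the `(θθp, q, r)` entry and the `(θq, θr, θp)` entry
  have hrefl : IsReflectionInvariantAlong τ K := fun n x => heuc.2 n (axisReflection τ) x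
  have row : ∀ {x : E³} (hx : 0 < (axisReflection τ x) τ),
      osSym K (cfg1 (axisReflection τ x) hx) (cfg2 q r hq hr hqr) = K 3 ![x, q, r] := by
    intro x hx
    -- second entry: `K₃(θq, θr, θx) = K₃(q, r, x) = K₃(x, q, r)`
    have h2 : K 3 ![axisReflection τ q, axisReflection τ r, axisReflection τ x] = K 3 ![x, q, r] := by
      have e1 : (![axisReflection τ q, axisReflection τ r, axisReflection τ x] : Fin 3 → E³) =
          fun i => axisReflection τ ((![q, r, x] : Fin 3 → E³) i) := by
        funext i; fin_cases i <;> rfl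
      rw [e1, hrefl]
      -- cyclic permutation
      have e2 : (![q, r, x] : Fin 3 → E³) = (![x, q, r] : Fin 3 → E³) ∘ (finRotate 3) := by
        funext i; fin_cases i <;> rfl
      rw [e2, hP]
    show (K 3 (Fin.append (fun i => axisReflection τ ((![axisReflection τ x] : Fin 1 → E³) i)) ![q, r])
      + K 3 (Fin.append (fun i => axisReflection τ ((![q, r] : Fin 2 → E³) i)) ![axisReflection τ x])) / 2
      = _
    rw [fin_append_one_two, fin_append_two_one]
    show (K 3 ![axisReflection τ (axisReflection τ x), q, r]
      + K 3 ![axisReflection τ q, axisReflection τ r, axisReflection τ x]) / 2 = _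
    rw [axisReflection_axisReflection, h2]
    ring
  rwa [row hθp, row hθp'] at key

/-- **`Δ = 0` rigidity at order three, invariant form.** If `p` and `p'` are strictly separated
from `q ≠ r` by an affine hyperplane (`⟪p,w⟫, ⟪p',w⟫ < c < ⟪q,w⟫, ⟪r,w⟫` for a unit vector `w`),
then `K₃(p,q,r) = K₃(p',q,r)`: translate the hyperplane to `c = 0` and rotate `w` onto `e_τ`
(`Submodule.reflection_sub`). Consequently `p ↦ K₃(p,q,r)` is locally constant off the segment
`[q,r]`, hence constant there (its complement in `ℝ³` is connected): a continuous, symmetric,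
Euclidean-invariant, weight-`0`, reflection-positive family is constant at order three (and, by
the same separation argument applied to `K₄(·, q, r, s)` off the triangle, at order four) — the
Schur product `GFF ⊙ K` with such a `K` is again conformally covariant. [folklore] -/
theorem scaleZero_three_eq_of_separated {K : CorrFamily 3} (τ : Fin 3)
    (hRP : IsReflectionPositiveAlong τ K)
    (heuc : IsEuclideanInvariant K) (hsc : IsScaleCovariant 0 K) (hP : IsPermutationSymmetric K)
    {p p' q r w : E³} {c : ℝ} (hw : ‖w‖ = 1) (hp : ⟪p, w⟫ < c) (hp' : ⟪p', w⟫ < c)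
    (hq : c < ⟪q, w⟫) (hr : c < ⟪r, w⟫) (hqr : q ≠ r) :
    K 3 ![p, q, r] = K 3 ![p', q, r] := by
  set e : E³ := EuclideanSpace.single τ 1 with he
  have he1 : ‖e‖ = 1 := by simp [he]
  -- an isometry `R` with `R w = e`
  obtain ⟨R, hRw⟩ : ∃ R : E³ ≃ₗᵢ[ℝ] E³, R w = e := by
    by_cases hwe : w = e
    · exact ⟨LinearIsometryEquiv.refl ℝ E³, by simp [hwe]⟩
    · exact ⟨Submodule.reflection (ℝ ∙ (w - e))ᗮ, Submodule.reflection_sub (by rw [hw, he1])⟩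
  -- the Euclidean motion `x ↦ R (x - c w)`; its `τ`-coordinate is `⟪x, w⟫ - c`
  have hcoord : ∀ x : E³, (R (x - c • w)) τ = ⟪x, w⟫ - c := by
    intro x
    have h1 : (R (x - c • w)) τ = ⟪R (x - c • w), e⟫ := by
      rw [he, EuclideanSpace.inner_single_right]; simp
    rw [h1, ← hRw, LinearIsometryEquiv.inner_map_map, inner_sub_left, real_inner_smul_left,
      real_inner_self_eq_norm_sq, hw]
    ring
  have hmove : ∀ x y z : E³, K 3 ![x, y, z] = K 3 ![R (x - c • w), R (y - c • w), R (z - c • w)] := by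
    intro x y z
    calc K 3 ![x, y, z] = K 3 (fun i => (![x, y, z] : Fin 3 → E³) i + -(c • w)) :=
          (heuc.1 3 (-(c • w)) ![x, y, z]).symm
      _ = K 3 (fun i => R ((fun j => (![x, y, z] : Fin 3 → E³) j + -(c • w)) i)) := (heuc.2 3 R _).symm
      _ = K 3 ![R (x - c • w), R (y - c • w), R (z - c • w)] := by
          congr 1
          funext i; fin_cases i <;> simp [sub_eq_add_neg]
  rw [hmove p q r, hmove p' q r]
  refine scaleZero_three_eq hRP heuc hsc hP ?_ ?_ ?_ ?_ ?_
  · rw [hcoord]; linarith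
  · rw [hcoord]; linarith
  · rw [hcoord]; linarith
  · rw [hcoord]; linarith
  · intro h
    exact hqr (sub_left_injective (R.injective h))

end ScaleZero

end ScaleZeroOpen

/-! ## §7' Open negative question (the only `sorry` of this file) -/

/-- **(LowΔ) — the sharpest open question on the negative side.** An RP DECOY IN THE WINDOW:
a family with (H3)–(H6), `Δ ∈ [1/2, 1]`, OS-positive along all three axes, NOT inversion
covariant. If it exists, every line using only "RP (all mirrors, all orders) + O(3) + scale +
Δ-window" dies at once (HyperoctahedralRP's whole positivity arsenal); if it provably does not,
that IS a proof strategy for the crux (RP passes to the limit from FILS lattice RP). Status: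
UNKNOWN, no candidate. Obstructions found: (a) the class {RP ∧ Euclid ∧ scale-`Δ` ∧ inversion
covariant} is closed under convex mixtures, independent products (Δ adds, Schur), Wick powers /
`O(N)` contractions of generalized free fields and locally uniform limits — every explicitly
solvable RP family in the window is conformal; (b) the only RP non-conformal scalar families known
are DERIVATIVE composites (`□χ`, `(∂χ)² = ½□χ²`, `∂·V`), of dimension `≥ 5/2 > 1`
(unitarity bounds `Δ_χ ≥ 1/2`, `Δ_V ≥ 2`), outside the window; (c) interacting scale-without-conformal
fixed points in `d = 3` (dipolar Aharony–Fisher, membranes) are non-unitary or vector-valued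
(GimenezgrauNakayamaRychkov2024 §1, §4.1); Maxwell₃ is free and a 2-form (ElshowkNakayamaRychkov2011);
(d) by §7'' a decoy has ALL even orders non-zero: no truncated witness, no finite-order perturbation
of a Gaussian. A positive answer needs a genuinely new positive-definite construction at all orders;
a negative answer is the physics folklore "unitarity + scale ⇒ conformal for a light scalar",
unproved in every `d ≥ 3`. [cite: PolandRychkovVichi2019, §I p. 3] -/
def rpDecoyInWindow : Prop :=
  ∃ (Δ : ℝ) (S : CorrFamily 3), Δ ∈ Set.Icc (1 / 2 : ℝ) 1 ∧
    (∀ n z, z ∉ NonCoincident 3 n → S n z = 0) ∧ IsNondegenerateTwoPoint S ∧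
    IsEuclideanInvariant S ∧ IsScaleCovariant Δ S ∧
    (∀ τ : Fin 3, IsReflectionPositiveAlong τ S) ∧ ¬ IsInversionCovariant Δ S

/-- NEAR-MISS (open): existence of an RP decoy in the window. Tried: Gaussian closure (all
conformal, cf. `Ideator2Sketch.gaussianFamilyInversionCovariant_holds`), scale mixtures of GFFs
(conformal), products (conformal), derivative decoys (`Δ ≥ 5/2`, cycle-1 CAS job j004948 for
`□:φ²:` at `Δ = 3`), positive perturbations `wick + ε·E` at the `{0,2}`-OS-block level (the
`{y₁y₂}{x₁x₂}` pairing term of any symmetric non-Wick `E` is indefinite), truncated families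
(never RP, §7''); cycle 3: finite-order deformations of the GFF (never RP: §8 downward rigidity,
`invIdentity_four_of_wick_eight`), Schur products `GFF ⊙ K` with weight-`0` RP `K` (rigid, §9),
Poissonian scaling soups (RP ⟺ Markov decomposition of the soup elements ⟹ permanental ⟹
conformal; rigid shapes not RP), mixtures of anisotropic RP Gaussians (RP along the three axes is
kept only termwise, so `O(3)`-averaging is unavailable; `B₃`-symmetric anisotropic Gaussians fail RP
in the six diagonal mirrors), vector-Gaussian composites `:A²:_ξ` / `|∇χ|²` (not RP unless `ξ = 1`,
computed, obstruction (i)). [folklore] -/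
theorem rpDecoyInWindow_undecided : rpDecoyInWindow := by
  sorry

/-! ## Targets (cycle 3)

Registered skeleton: line `inversion-defect-involution` (lead `prover-line-stmt-CriticalPhenomena-1982-0`),
open stubs C = `stub_latticeFour`, D = `stub_latticeHigher` (A, B landed: p71996, p71926). -/

/-- **C ∧ D ⇔ crux** (re-export of the lead's `InversionUpgradeNormalised_iff_latticeOneSided`,
`Theorems/HyperoctahedralRPInversionUpgradeNormalisedConditional.lean`, p72769): the two registered
targets are JOINTLY EQUIVALENT to the crux — C is the `n = 4` inversion identity of the pinned limit
in Δ-free, ρ-free lattice clothing (zero slack: the one-sided ball-restricted ratio inequality forces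
equality by the squeeze), D the orders `≥ 6`. Consequently no `stub_false` theorem exists for C or D
unless the crux itself is false; the disprover's attacks on them ARE the attacks on the crux (§1–§9).
Their ε-free sharpening is false in `d = 2` (exact computation, item evidence `stub_latticeFour-g2.md`),
so C cannot be strengthened to a finite-mesh domination either. [folklore] -/
theorem targets_iff_crux :
    Summit.CriticalPhenomena.Ising3DConformalLimit.Theses.HyperoctahedralRP.InversionUpgradeNormalised ↔
    ((∀ (ρ : ℝ → ℝ) (Δ : ℝ) (S : CorrFamily 3), (∀ δ ∈ Set.Ioc (0:ℝ) 1, 0 < ρ δ) →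
      HasPointwiseScalingLimit (criticalCorr 3) ρ S →
      (∀ n z, z ∉ NonCoincident 3 n → S n z = 0) → IsNondegenerateTwoPoint S →
      IsEuclideanInvariant S → IsScaleCovariant Δ S →
      ∀ x : Fin (2 + 2) → EuclideanSpace ℝ (Fin 3), x ∈ NonCoincident 3 (2 + 2) →
        (∀ i, x i ≠ 0) → (∀ i, ‖x i‖ < 1) →
        ∀ ε : ℝ, 0 < ε → ∀ᶠ δ in 𝓝[>] (0:ℝ),
          criticalCorr 3 2 (fun i => latticeApprox δ (x (Fin.castAdd 2 i))) *
              criticalCorr 3 2 (fun i => latticeApprox δ (x (Fin.natAdd 2 i))) /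
            criticalCorr 3 (2 + 2) (fun i => latticeApprox δ (x i)) ≤
          criticalCorr 3 2 (fun i => latticeApprox δ (inversion 0 1 (x (Fin.castAdd 2 i)))) *
              criticalCorr 3 2 (fun i => latticeApprox δ (inversion 0 1 (x (Fin.natAdd 2 i)))) /
            criticalCorr 3 (2 + 2) (fun i => latticeApprox δ (inversion 0 1 (x i))) + ε) ∧
    (∀ (ρ : ℝ → ℝ) (Δ : ℝ) (S : CorrFamily 3), (∀ δ ∈ Set.Ioc (0:ℝ) 1, 0 < ρ δ) →
      HasPointwiseScalingLimit (criticalCorr 3) ρ S →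
      (∀ n z, z ∉ NonCoincident 3 n → S n z = 0) → IsNondegenerateTwoPoint S →
      IsEuclideanInvariant S → IsScaleCovariant Δ S →
      ∀ n : ℕ, Even n → 4 ≤ n →
        ∀ x : Fin (n + 2) → EuclideanSpace ℝ (Fin 3), x ∈ NonCoincident 3 (n + 2) →
          (∀ i, x i ≠ 0) → (∀ i, ‖x i‖ < 1) →
          ∀ ε : ℝ, 0 < ε → ∀ᶠ δ in 𝓝[>] (0:ℝ),
          criticalCorr 3 n (fun i => latticeApprox δ (x (Fin.castAdd 2 i))) *
              criticalCorr 3 2 (fun i => latticeApprox δ (x (Fin.natAdd n i))) /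
            criticalCorr 3 (n + 2) (fun i => latticeApprox δ (x i)) ≤
          criticalCorr 3 n (fun i => latticeApprox δ (inversion 0 1 (x (Fin.castAdd 2 i)))) *
              criticalCorr 3 2 (fun i => latticeApprox δ (inversion 0 1 (x (Fin.natAdd n i)))) /
            criticalCorr 3 (n + 2) (fun i => latticeApprox δ (inversion 0 1 (x i))) + ε)) :=
  InversionDefectInvolution.InversionUpgradeNormalised_iff_latticeOneSided

/-- Summary marker (docstring = the verdict; see the module docstring "Why it resists"). [folklore] -/
theorem resists : True := trivial

end Summit.CriticalPhenomena.Ising3DConformalLimit.Cruxes.InversionUpgradeNormalised.Disproof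

end
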